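import Literature.Probability.Percolation.QuadCrossingExplorationCharts
import Literature.Probability.Percolation.QuadCrossingBelowRegion
import Literature.Probability.Percolation.QuadCrossingPathReparam
import Literature.Probability.Percolation.QuadCrossingPathCrossings
import Literature.Probability.Percolation.QuadCrossingFlip
import HarnessLib

/-!
# Below the lowest crossing: region, freshness, exit set, no inversion, access (proofs towards Schramm–Smirnov Lemma 6.1)

## Part: QuadCrossingExplorationBelow

# Below a frontier crossing: the region, its side trace, and no contacts below accessible side points

Topic `Probability/Percolation`; chart-level proofs file towards the named fact
`SchrammSmirnov2011_lemma_6_1` (`QuadCrossingContinuity.lean`; O. Schramm, S. Smirnov, *On the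
scaling limits of planar percolation*, Ann. Probab. 39 (2011), arXiv:1101.5820, proof of Lemma 6.1,
p. 22: "Let `M` be the connected component of `[Q'] ∖ γ` which has `∂₁Q'` on its boundary").

For a frame `Φ` (`QuadDualExploration.lean`) and a continuum `C ⊆ R'` joining the two vertical sides
of the extended rectangle `R'' = [a,b] × [c-η,d]` (a frontier crossing of the explored region,
`QuadCrossingExplorationLanding.lean`), `Frame.belowSet C` is the set of points of `R''` joined to the
bottom side of `R''` inside `R'' ∖ C` — "the part of `[Q']` below the lowest crossing", including the
explored region (`explored_subset_belowSet`).  Proved here, all with the continuum–path crossing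
lemma of `RectangleDuality.lean`:

* `im_lt_d_of_mem_belowSet` — it misses the top side;
* `im_le_of_mem_closure_belowSet` — its closure meets the right side only below the highest
  right-side point of `C` (hence below the landing height);
* `im_lt_of_mem_closure_belowSet_right` / `…_left` — **no contact of `C` below an accessible side
  point**: if a point `y` of the right (left) side lies in `closure (belowSet C) ∖ C`, every
  right- (left-) side point of `C` is strictly higher than `y`.  (Extend the rectangle by one unit
  to the right, extend `C` by the horizontal unit segment at a lower contact `z`, and run from the
  bottom to `y`, one unit to the right and up: a bottom-to-top path missing the extended
  continuum.)  Consequently the side below such a `y` down to the corner misses `C`.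

Everything is proved; no named fact is introduced.

## References

* O. Schramm, S. Smirnov, Ann. Probab. 39 (2011) 1768–1814, arXiv:1101.5820, proof of Lemma 6.1.
  [SchrammSmirnov2011]

## Part: QuadCrossingExplorationFresh

# The explored region lies below the lowest crossing and its exit set (freshness of the upper region)

Topic `Probability/Percolation`; proofs file towards the named fact `SchrammSmirnov2011_lemma_6_1`
(`QuadCrossingContinuity.lean`; O. Schramm, S. Smirnov, *On the scaling limits of planar
percolation*, Ann. Probab. 39 (2011), arXiv:1101.5820, proof of Lemma 6.1, p. 22: "Let `M` be the
connected component of `[Q'] ∖ γ` which has `∂₁Q'` on its boundary … The lowest crossing `γ`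
depends only on the configuration inside `M`, so the restriction of `ω` to `[Q] ∖ M` is unbiased").

In the tree `M` is realised, inside the LARGER quad `Q`, as the region below
`W = L ∪ E` (`QuadCrossingBelowRegion.lean`), where `L = G(Γ)` is the image of the lowest crossing
(a frontier crossing of the explored region `Λ` of the smaller quad `Q'`,
`QuadLowestCrossingProofs.lean`) and `E ∋ x` is the exit set near the endpoint
`x = G(wallPt)` (a short junction of `x` to `∂₂Q` together with the short arc of `∂₂Q'` below `x`
carrying its contacts).  The decoupling needs that **the explored (= revealed) region of `Q'` lies
inside `M`**: then closed revealed edges meet `[Q] ∖ M` only next to `E` (tameness), and the dual arm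
extracted above `M` is fresh.  This is `Frame.Charts.image_explored_subset_below`: under

* `G(Â) ⊆ E` for the right-side arc `Â = {re = b, m ≤ im ≤ wallTop}` of the chart rectangle,
* every right-side chart point drawn into `E` has height `≥ m`, and `E` misses `∂₀Q'`,

every point of `G(Λ ∩ R')` is below `W` in `[Q]`.  Proof (contrapositive): a path of `[Q]` from an
explored point to `∂₃Q` missing `W` is followed in the chart until it first leaves `[Q']`, at a
point `e` of `∂Q'`; up to there it stays below `Γ` (`belowSet`, `QuadCrossingExplorationBelow.lean`),
so `e` is not on the top side; on the right side it lies below the landing height, hence (missing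
`E ⊇ G(Â)`) below `m`, and then the side below `e` down to the corner `Q'(1,0) ∈ ∂₁Q` misses `Γ`
(no contact of `Γ` below an accessible side point) and `E`; similarly on the left side; on the
bottom side `e ∈ ∂₁Q` already.  In all cases `e` is joined to `∂₁Q ⊆ M` off `W`, so `e ∈ M`,
while the rest of the path joins `e` to `∂₃Q` off `W` — contradiction.  Everything is proved.

## References

* O. Schramm, S. Smirnov, Ann. Probab. 39 (2011) 1768–1814, arXiv:1101.5820, proof of Lemma 6.1.
  [SchrammSmirnov2011]

## Part: QuadCrossingExplorationExitSet

# The exit set at the endpoint of the lowest crossing: short junction plus short boundary arc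

Topic `Probability/Percolation`; proofs file towards the named fact `SchrammSmirnov2011_lemma_6_1`
(`QuadCrossingContinuity.lean`; O. Schramm, S. Smirnov, *On the scaling limits of planar
percolation*, Ann. Probab. 39 (2011), arXiv:1101.5820, proof of Lemma 6.1, p. 22, and condition (2):
"each point on `∂₂Q'` can be connected to `∂₂Q` by a path `α ⊂ [Q]` with `diam(α) ≤ δ`").

For the decoupling step the region "below the lowest crossing" is realised in the larger quad `Q`
as the region below `W = L ∪ E` (`QuadCrossingBelowRegion.lean`, `QuadCrossingExplorationFresh.lean`),
where `L = G(Γ)` is the lowest crossing and the **exit set** `E ∋ x` collects the short junction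
`α₀` of the endpoint `x = G(wallPt)` to `∂₂Q` together with the arc `G(Â)` of `∂₂Q'` just below `x`
carrying all contacts of `α₀` with `∂₂Q'` (`Â = {re = b, m ≤ im ≤ wallTop}`, `m` the lowest height
of a right-side chart point drawn onto `α₀`).  `Frame.Charts.exists_exitSet` constructs `E` and
verifies what `Charts.image_explored_subset_below` / `Charts.mem_range_or_exists_mem_of_revealedIn`
and `Quad.mem_annulusDualCrossingOff_of_not_exists_isCrossing` ask of it: compact, preconnected, in
`[Q]`, containing `x`, meeting `∂₂Q`, missing `∂₀Q'`, `G(Â) ⊆ E`, right-side contacts of `E` at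
height `≥ m`, and every point of `E` joined to `x` inside `[Q]` within distance `K ρ` of `x`.  The
last point is where the mild regularity of the free side enters (hypothesis `harc`: two points of
`∂₂Q'` at distance `≤ ρ` span a sub-arc of `∂₂Q'` staying within `K ρ` of the first — true for the
piecewise-smooth quads of the applications, an assumption for general ones).  Everything is proved.

## References

* O. Schramm, S. Smirnov, Ann. Probab. 39 (2011) 1768–1814, arXiv:1101.5820, Lemma 6.1 (2) and its
  proof. [SchrammSmirnov2011]

## Part: QuadCrossingNoInversion

# No inversion: the lowest crossing lands below the uppermost crossing

Topic `Probability/Percolation`; proofs file towards the named fact `SchrammSmirnov2011_lemma_6_1`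
(`QuadCrossingContinuity.lean`; O. Schramm, S. Smirnov, *On the scaling limits of planar
percolation*, Ann. Probab. 39 (2011), arXiv:1101.5820, proof of Lemma 6.1: "We will work with
configurations with a crossing landing on `σ₃`, the other case being symmetric" — the symmetric
case uses the uppermost crossing, and combining the two cases needs that the landing point of the
lowest crossing is not above the landing point of the uppermost one).

The combinatorial heart, in a rectangle `[a, b] × [c - η, d + η]` of the chart: let `Λ₁` (explored
from the bottom row) and `Λ₃` (explored from the top row) be disjoint sets, `Λ₁` below height `d`,
`Λ₃` above height `c`, both in `re ≤ b`.  If a path runs from the bottom row to a right-side point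
`p_H` through `Λ₁` (all its other points in `Λ₁`) and another from the top row to a right-side point
`p_L` through `Λ₃`, with `p_H ∉ Λ₃`, `p_L ∉ Λ₁`, then `im p_H ≤ im p_L`
(`im_le_im_of_access`).  Proof: otherwise extend the first path to the right at height `im p_H` and
up along `re = b + 1` (a bottom-to-top path of `[a, b+1] × [c-η, d+η]`), and the second to the
right at height `im p_L` and to the left along the top row (a left-to-right continuum); they meet
(`exists_mem_of_isPreconnected_crossing`), and every possible meeting point is excluded.  The access
paths are supplied, for tame quads, by the local wedge structure of the free side.  Everything is
proved.

## References

* O. Schramm, S. Smirnov, Ann. Probab. 39 (2011) 1768–1814, arXiv:1101.5820, proof of Lemma 6.1.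
  [SchrammSmirnov2011]

## Part: QuadCrossingExplorationAccess

# Access to the landing point from the explored region (locally star-shaped free side)

Topic `Probability/Percolation`; proofs file towards the named fact `SchrammSmirnov2011_lemma_6_1`
(`QuadCrossingContinuity.lean`; O. Schramm, S. Smirnov, *On the scaling limits of planar
percolation*, Ann. Probab. 39 (2011), arXiv:1101.5820, proof of Lemma 6.1).

The no-inversion theorem (`QuadCrossingNoInversion.lean`, `QuadCrossingExplorationFlipFrame.lean`)
needs an **access path**: a path from an explored point to the wall point `wallPt` all of whose
other points are explored.  `Frame.Charts.exists_access` provides it when the charted quad is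
locally star-shaped at the landing point `x = G(wallPt)` (hypothesis `hstar`: segments from `x`
to nearby points of `[Q']` stay in `[Q']` — true for polygonal and piecewise-smooth free sides):
near `x` the drawn lattice reduces to the open edge segments through `x` (and `x` itself), which
are radially closed, so the straight segment from a nearby explored point to `x`, pulled back by
the chart, is an access path.  Everything is proved.

## References

* O. Schramm, S. Smirnov, Ann. Probab. 39 (2011) 1768–1814, arXiv:1101.5820, proof of Lemma 6.1.
  [SchrammSmirnov2011]

## Part: QuadCrossingExplorationFlipFrame

# The flipped frame: exploring from the top in the same chart, and no inversion

Topic `Probability/Percolation`; proofs file towards the named fact `SchrammSmirnov2011_lemma_6_1`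
(`QuadCrossingContinuity.lean`; O. Schramm, S. Smirnov, *On the scaling limits of planar
percolation*, Ann. Probab. 39 (2011), arXiv:1101.5820, proof of Lemma 6.1, "the other case
being symmetric").

`Frame.flipFrame Φ` precomposes the chart with complex conjugation and reflects the rectangle:
it charts the flipped quad `Q'.flip` (`QuadCrossingFlip.lean`) whenever `Φ` charts `Q'`
(`Charts.flipFrame`), so that its exploration "from `∂₁(Q'.flip) = ∂₃Q'`" is, after conjugating
back, the exploration of `R'` **from the top** in the chart of `Φ`.  The two explored regions are
disjoint as soon as `Q'` is crossed (`disjoint_explored_flip`), and the abstract no-inversion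
theorem (`QuadCrossingNoInversion.lean`) gives: granted access paths to the two wall points,
`wallTop Φ + wallTop Φ.flipFrame ≤ 0`, i.e. the landing point of the lowest crossing is not above
the landing point of the uppermost one (`wallTop_add_wallTop_le`).  Everything is proved.

## References

* O. Schramm, S. Smirnov, Ann. Probab. 39 (2011) 1768–1814, arXiv:1101.5820, proof of Lemma 6.1.
  [SchrammSmirnov2011]
-/

noncomputable section

/-! ## Part `QuadCrossingExplorationBelow` -/

section
open Set Metric Filter Function Complex
open _root_.Topology
open Literature.Probability.LatticeModels
open Literature.Topology.PlaneTopology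

namespace Literature.Probability.Percolation

namespace SSContinuity

namespace Frame

variable (Φ : Frame)

/-! ### Points of segments -/

/-- Coordinates along a segment. [folklore] -/
theorem exists_of_mem_segment {u v w : ℂ} (hw : w ∈ segment ℝ u v) :
    ∃ t ∈ Icc (0 : ℝ) 1, w.re = u.re + t * (v.re - u.re) ∧ w.im = u.im + t * (v.im - u.im) := by
  rw [segment_eq_image_lineMap] at hw
  obtain ⟨t, ht, rfl⟩ := hw
  refine ⟨t, ht, ?_, ?_⟩
  · simp only [AffineMap.lineMap_apply_module', add_re, smul_re, sub_re, smul_eq_mul]; ring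
  · simp only [AffineMap.lineMap_apply_module', add_im, smul_im, sub_im, smul_eq_mul]; ring

/-- A point of the horizontal segment `[z, z + s]` (`s` real) other than `z` has larger real part,
and all its points have the height of `z`. [folklore] -/
theorem re_im_of_mem_segment_add {z w : ℂ} {s : ℝ} (hw : w ∈ segment ℝ z (z + s)) :
    w.im = z.im ∧ ∃ t ∈ Icc (0 : ℝ) 1, w.re = z.re + t * s := by
  obtain ⟨t, ht, hre, him⟩ := exists_of_mem_segment hw
  refine ⟨by simpa using him, t, ht, by simpa using hre⟩

/-! ### The region below a continuum -/

/-- **The region of `R''` below `C`**: points of `R''` joined to the bottom side of `R''` inside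
`R'' ∖ C` ("the component of `[Q'] ∖ γ` which has `∂₁Q'` on its boundary", for `γ = G(C)`).
[cite: SchrammSmirnov2011, proof of Lemma 6.1] -/
def belowSet (C : Set ℂ) : Set ℂ :=
  {u | u ∈ Φ.extRect ∧ ∃ p ∈ Φ.bottom, JoinedIn (Φ.extRect \ C) p u}

variable {C : Set ℂ}

/-- `belowSet C ⊆ R''`. [folklore] -/
theorem belowSet_subset_extRect : Φ.belowSet C ⊆ Φ.extRect := fun _ h => h.1

/-- `closure (belowSet C) ⊆ R''`. [folklore] -/
theorem closure_belowSet_subset_extRect : closure (Φ.belowSet C) ⊆ Φ.extRect :=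
  closure_minimal Φ.belowSet_subset_extRect Φ.isClosed_extRect

/-- Bottom points are below any `C ⊆ R'`. [folklore] -/
theorem mem_belowSet_of_mem_bottom (hCr : C ⊆ Φ.rect) {p : ℂ} (hp : p ∈ Φ.bottom) :
    p ∈ Φ.belowSet C := by
  have hpE : p ∈ Φ.extRect := Φ.bottom_subset_extRect hp
  have hpC : p ∉ C := fun h => by
    have h1 : Φ.c ≤ p.im := (hCr h).2.1
    have h2 : p.im = Φ.c - Φ.η := by simpa [bottom, mem_reProdIm] using hp.2
    linarith [Φ.hη]
  exact ⟨hpE, p, hp, JoinedIn.refl ⟨hpE, hpC⟩⟩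

/-- Points joined inside `R'' ∖ C` to a point below `C` are below `C`. [folklore] -/
theorem mem_belowSet_of_joinedIn {u v : ℂ} (hu : u ∈ Φ.belowSet C)
    (hJ : JoinedIn (Φ.extRect \ C) u v) : v ∈ Φ.belowSet C := by
  obtain ⟨-, p, hp, hpu⟩ := hu
  exact ⟨hJ.target_mem.1, p, hp, hpu.trans hJ⟩

/-- **The explored region is below every `C` made of obstacles.** [cite: SchrammSmirnov2011, proof of Lemma 6.1] -/
theorem explored_subset_belowSet {ω : BondConfig (Site 2)} (hC : C ⊆ Φ.obstacle ω) :
    Φ.explored ω ⊆ Φ.belowSet C := by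
  rintro u ⟨huE, p, hp, hJ⟩
  exact ⟨huE, p, hp, hJ.mono (Set.sdiff_subset_sdiff_right hC)⟩

/-- A closure point of `belowSet C` off the closed set `C` is below `C` (join it by a short segment).
[folklore] -/
theorem mem_belowSet_of_mem_closure (hCcl : IsClosed C) {u : ℂ} (hu : u ∈ closure (Φ.belowSet C))
    (huC : u ∉ C) : u ∈ Φ.belowSet C := by
  have huE : u ∈ Φ.extRect := Φ.closure_belowSet_subset_extRect hu
  obtain ⟨r, hr, hball⟩ : ∃ r > 0, ball u r ⊆ Cᶜ := Metric.isOpen_iff.1 hCcl.isOpen_compl u huC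
  obtain ⟨v, hv, hvd⟩ := Metric.mem_closure_iff.1 hu r hr
  refine Φ.mem_belowSet_of_joinedIn hv (JoinedIn.ofLine (f := fun t : ℝ => AffineMap.lineMap v u t)
    AffineMap.lineMap_continuous.continuousOn (AffineMap.lineMap_apply_zero _ _)
    (AffineMap.lineMap_apply_one _ _) ?_)
  rw [← segment_eq_image_lineMap]
  intro w hw
  exact ⟨Φ.convex_extRect.segment_subset hv.1 huE hw,
    hball ((convex_ball u r).segment_subset (mem_ball'.2 hvd) (mem_ball_self hr) hw)⟩

/-- A path from the bottom side to a point below `C`, inside `R'' ∖ C`, with a prescribed last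
segment: if `v ∈ belowSet C` and `[v, u] ⊆ R'' ∖ C`, some path of `R'' ∖ C` joins a bottom point to
`u`. [folklore] -/
theorem exists_path_of_segment_subset {u v : ℂ} (hv : v ∈ Φ.belowSet C)
    (hseg : segment ℝ v u ⊆ Φ.extRect \ C) :
    ∃ p ∈ Φ.bottom, ∃ γ : Path p u, ∀ s, γ s ∈ Φ.extRect \ C := by
  have hu := Φ.mem_belowSet_of_joinedIn hv (JoinedIn.ofLine (f := fun t : ℝ => AffineMap.lineMap v u t)
    AffineMap.lineMap_continuous.continuousOn (AffineMap.lineMap_apply_zero _ _)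
    (AffineMap.lineMap_apply_one _ _) (by rw [← segment_eq_image_lineMap]; exact hseg))
  obtain ⟨-, p, hp, γ, hγ⟩ := hu
  exact ⟨p, hp, γ, hγ⟩

/-! ### No top point below a frontier crossing -/

/-- **`belowSet C` misses the top side** when `C ⊆ R'` is a continuum joining the two vertical sides
of `R''`: a path of `R'' ∖ C` from the bottom side to the top side contradicts the crossing lemma.
[cite: SchrammSmirnov2011, proof of Lemma 6.1] -/
theorem im_lt_d_of_mem_belowSet (hCc : IsCompact C) (hCpc : IsPreconnected C) (hCr : C ⊆ Φ.rect)
    (hCa : ∃ z ∈ C, z.re = Φ.a) (hCb : ∃ z ∈ C, z.re = Φ.b) {u : ℂ} (hu : u ∈ Φ.belowSet C) :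
    u.im < Φ.d := by
  obtain ⟨huE, p, hp, γ, hγ⟩ := hu
  by_contra hge
  push Not at hge
  have hud : u.im = Φ.d := le_antisymm huE.2.2 hge
  have hpim : p.im = Φ.c - Φ.η := by simpa [bottom, mem_reProdIm] using hp.2
  have hac : Φ.c - Φ.η ≤ Φ.d := by linarith [Φ.hcd, Φ.hη]
  obtain ⟨t, ht, htC⟩ := exists_mem_of_isPreconnected_crossing Φ.hab.le hac hCc hCpc
    (fun z hz => Φ.rect_subset_extRect (hCr hz)) hCa hCb (β := fun t => γ.extend t)
    γ.continuous_extend.continuousOn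
    (fun t ht => by show γ.extend t ∈ _; rw [γ.extend_apply ht]; exact (hγ _).1)
    (show (γ.extend 0).im = Φ.c - Φ.η by rw [γ.extend_zero, hpim])
    (show (γ.extend 1).im = Φ.d by rw [γ.extend_one, hud])
  rw [γ.extend_apply ht] at htC
  exact (hγ _).2 htC

/-! ### The right-side trace of the closure -/

/-- **Closure points of `belowSet C` on the right side lie below the highest right-side point of
`C`**: if every right-side point of `C` has height `≤ h` and `y ∈ closure (belowSet C)` has
`re y = b`, then `im y ≤ h`.  (If `y ∉ C`: a path of `R'' ∖ C` from the bottom to `y` followed by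
the side above `y` would join bottom to top off `C`.) [cite: SchrammSmirnov2011, proof of Lemma 6.1] -/
theorem im_le_of_mem_closure_belowSet (hCc : IsCompact C) (hCpc : IsPreconnected C) (hCr : C ⊆ Φ.rect)
    (hCa : ∃ z ∈ C, z.re = Φ.a) (hCb : ∃ z ∈ C, z.re = Φ.b) {h : ℝ}
    (hmax : ∀ z ∈ C, z.re = Φ.b → z.im ≤ h) {y : ℂ} (hy : y ∈ closure (Φ.belowSet C))
    (hyre : y.re = Φ.b) : y.im ≤ h := by
  by_cases hyC : y ∈ C
  · exact hmax y hyC hyre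
  by_contra hlt
  push Not at hlt
  have hy' := Φ.mem_belowSet_of_mem_closure hCc.isClosed hy hyC
  obtain ⟨hyE, p, hp, γ, hγ⟩ := hy'
  have hpim : p.im = Φ.c - Φ.η := by simpa [bottom, mem_reProdIm] using hp.2
  -- the side above `y`
  set q : ℂ := ⟨Φ.b, Φ.d⟩ with hq
  have hqE : q ∈ Φ.extRect :=
    ⟨⟨Φ.hab.le, le_rfl⟩, ⟨by simp [hq]; linarith [Φ.hcd, Φ.hη], by simp [hq]⟩⟩
  set P : Path p q := γ.trans (segPath y q) with hP
  have hPrange : range P ⊆ Φ.extRect \ C := by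
    rw [hP, Path.trans_range, range_segPath]
    refine union_subset ?_ ?_
    · rintro _ ⟨s, rfl⟩; exact hγ s
    · intro z hz
      refine ⟨Φ.convex_extRect.segment_subset hyE hqE hz, fun hzC => ?_⟩
      obtain ⟨t, ht, hre, him⟩ := exists_of_mem_segment hz
      have hzre : z.re = Φ.b := by rw [hre, hyre]; simp [hq]
      have h1 := hmax z hzC hzre
      have hyd : y.im ≤ Φ.d := hyE.2.2
      have : z.im = y.im + t * (Φ.d - y.im) := by rw [him]
      nlinarith [ht.1, ht.2]
  have hac : Φ.c - Φ.η ≤ Φ.d := by linarith [Φ.hcd, Φ.hη]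
  obtain ⟨t, ht, htC⟩ := exists_mem_of_isPreconnected_crossing Φ.hab.le hac hCc hCpc
    (fun z hz => Φ.rect_subset_extRect (hCr hz)) hCa hCb (β := fun t => P.extend t)
    P.continuous_extend.continuousOn
    (fun t ht => by show P.extend t ∈ _; rw [P.extend_apply ht]; exact (hPrange (mem_range_self _)).1)
    (show (P.extend 0).im = Φ.c - Φ.η by rw [P.extend_zero, hpim])
    (show (P.extend 1).im = Φ.d by rw [P.extend_one])
  rw [P.extend_apply ht] at htC
  exact (hPrange (mem_range_self _)).2 htC

/-! ### No contact of `C` below an accessible side point -/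

/-- **No right-side contact of `C` below an accessible right-side point.**  If `y ∈ closure
(belowSet C) ∖ C` lies on the right side, every right-side point of `C` is strictly higher than
`y`. [cite: SchrammSmirnov2011, proof of Lemma 6.1] -/
theorem im_lt_of_mem_closure_belowSet_right (hCc : IsCompact C) (hCpc : IsPreconnected C)
    (hCr : C ⊆ Φ.rect) (hCa : ∃ z ∈ C, z.re = Φ.a) {y : ℂ} (hy : y ∈ closure (Φ.belowSet C))
    (hyC : y ∉ C) (hyre : y.re = Φ.b) {z : ℂ} (hz : z ∈ C) (hzre : z.re = Φ.b) : y.im < z.im := by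
  by_contra hle
  push Not at hle
  have hzy : z.im < y.im := by
    rcases hle.eq_or_lt with h | h
    · exact absurd (Complex.ext (hzre.trans hyre.symm) h ▸ hz) hyC
    · exact h
  -- a path of `R'' ∖ C` from the bottom to `y`
  have hy' := Φ.mem_belowSet_of_mem_closure hCc.isClosed hy hyC
  obtain ⟨hyE, p, hp, γ, hγ⟩ := hy'
  have hpim : p.im = Φ.c - Φ.η := by simpa [bottom, mem_reProdIm] using hp.2
  -- the extended rectangle and continuum
  set R : Set ℂ := Icc Φ.a (Φ.b + 1) ×ℂ Icc (Φ.c - Φ.η) Φ.d with hR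
  have hRconv : Convex ℝ R := convex_Icc_reProdIm_Icc _ _ _ _
  have hER : Φ.extRect ⊆ R := fun w hw => ⟨⟨hw.1.1, hw.1.2.trans (by linarith)⟩, hw.2⟩
  set K : Set ℂ := C ∪ segment ℝ z (z + (1 : ℝ)) with hK
  have hz1 : z + (1 : ℝ) ∈ R := by
    have hzR := hER (Φ.rect_subset_extRect (hCr hz))
    exact ⟨⟨by simp; linarith [hzR.1.1], by simp [hzre]⟩, by simpa using hzR.2⟩
  have hKsub : K ⊆ R := union_subset (fun w hw => hER (Φ.rect_subset_extRect (hCr hw)))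
    (hRconv.segment_subset (hER (Φ.rect_subset_extRect (hCr hz))) hz1)
  have hKc : IsCompact K := hCc.union (isCompact_segment_complex _ _)
  have hKpc : IsPreconnected K :=
    (hCpc.union z hz (left_mem_segment ℝ _ _) (convex_segment _ _).isPreconnected)
  have hKa : ∃ w ∈ K, w.re = Φ.a := by
    obtain ⟨w, hw, hwre⟩ := hCa; exact ⟨w, Or.inl hw, hwre⟩
  have hKb : ∃ w ∈ K, w.re = Φ.b + 1 := ⟨z + (1 : ℝ), Or.inr (right_mem_segment ℝ _ _), by simp [hzre]⟩
  -- the path: bottom → y → y + 1 → top-right corner of `R`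
  set y1 : ℂ := y + (1 : ℝ) with hy1
  set q : ℂ := ⟨Φ.b + 1, Φ.d⟩ with hq
  have hyR : y ∈ R := hER hyE
  have hy1R : y1 ∈ R := ⟨⟨by simp [hy1]; linarith [hyR.1.1], by simp [hy1, hyre]⟩, by simpa [hy1] using hyR.2⟩
  have hqR : q ∈ R := ⟨⟨by simp [hq]; linarith [Φ.hab], by simp [hq]⟩,
    ⟨by simp [hq]; linarith [Φ.hcd, Φ.hη], by simp [hq]⟩⟩
  -- no point of `K` on the three added pieces, nor on `γ`
  have hKseg : ∀ w ∈ segment ℝ z (z + (1 : ℝ)), w.im = z.im ∧ z.re ≤ w.re := fun w hw => by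
    obtain ⟨him, t, ht, hre⟩ := re_im_of_mem_segment_add hw
    exact ⟨him, by rw [hre]; nlinarith [ht.1]⟩
  have hnotK : ∀ w, w ∈ K → w.re ≤ Φ.b → w ∈ C := by
    rintro w (hw | hw) hwre
    · exact hw
    · obtain ⟨him, t, ht, hre⟩ := re_im_of_mem_segment_add hw
      have ht0 : t = 0 := by
        rw [hzre] at hre
        nlinarith [ht.1]
      have : w = z := Complex.ext (by rw [hre, ht0]; ring) him
      rw [this]; exact hz
  set P : Path p q := (γ.trans (segPath y y1)).trans (segPath y1 q) with hP
  have hPrange : range P ⊆ R \ K := by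
    rw [hP, Path.trans_range, Path.trans_range, range_segPath, range_segPath]
    refine union_subset (union_subset ?_ ?_) ?_
    · rintro _ ⟨s, rfl⟩
      refine ⟨hER (hγ s).1, fun hsK => (hγ s).2 (hnotK _ hsK (hγ s).1.1.2)⟩
    · intro w hw
      refine ⟨hRconv.segment_subset hyR hy1R hw, fun hwK => ?_⟩
      obtain ⟨him, t, ht, hre⟩ := re_im_of_mem_segment_add hw
      rcases hwK with hwC | hwS
      · -- `re w ≤ b` forces `w = y ∉ C`
        have hwre : w.re ≤ Φ.b := (hCr hwC).1.2
        have ht0 : t = 0 := by rw [hyre] at hre; nlinarith [ht.1]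
        have : w = y := Complex.ext (by rw [hre, ht0]; ring) him
        exact hyC (this ▸ hwC)
      · have := (hKseg w hwS).1
        rw [him] at this
        linarith
    · intro w hw
      refine ⟨hRconv.segment_subset hy1R hqR hw, fun hwK => ?_⟩
      obtain ⟨t, ht, hre, him⟩ := exists_of_mem_segment hw
      have hwre : w.re = Φ.b + 1 := by rw [hre]; simp [hy1, hq, hyre]
      rcases hwK with hwC | hwS
      · have := (hCr hwC).1.2
        rw [hwre] at this; linarith
      · have h1 := (hKseg w hwS).1
        have hyd : y.im ≤ Φ.d := hyR.2.2
        have : w.im = y.im + t * (Φ.d - y.im) := by rw [him]; simp [hy1, hq]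
        rw [this] at h1
        nlinarith [ht.1, ht.2]
  have hac : Φ.c - Φ.η ≤ Φ.d := by linarith [Φ.hcd, Φ.hη]
  obtain ⟨t, ht, htK⟩ := exists_mem_of_isPreconnected_crossing (show Φ.a ≤ Φ.b + 1 by linarith [Φ.hab])
    hac hKc hKpc hKsub hKa hKb (β := fun t => P.extend t) P.continuous_extend.continuousOn
    (fun t ht => by show P.extend t ∈ _; rw [P.extend_apply ht]; exact (hPrange (mem_range_self _)).1)
    (show (P.extend 0).im = Φ.c - Φ.η by rw [P.extend_zero, hpim])
    (show (P.extend 1).im = Φ.d by rw [P.extend_one])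
  rw [P.extend_apply ht] at htK
  exact (hPrange (mem_range_self _)).2 htK

/-- **No left-side contact of `C` below an accessible left-side point** (mirror image).
[cite: SchrammSmirnov2011, proof of Lemma 6.1] -/
theorem im_lt_of_mem_closure_belowSet_left (hCc : IsCompact C) (hCpc : IsPreconnected C)
    (hCr : C ⊆ Φ.rect) (hCb : ∃ z ∈ C, z.re = Φ.b) {y : ℂ} (hy : y ∈ closure (Φ.belowSet C))
    (hyC : y ∉ C) (hyre : y.re = Φ.a) {z : ℂ} (hz : z ∈ C) (hzre : z.re = Φ.a) : y.im < z.im := by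
  by_contra hle
  push Not at hle
  have hzy : z.im < y.im := by
    rcases hle.eq_or_lt with h | h
    · exact absurd (Complex.ext (hzre.trans hyre.symm) h ▸ hz) hyC
    · exact h
  have hy' := Φ.mem_belowSet_of_mem_closure hCc.isClosed hy hyC
  obtain ⟨hyE, p, hp, γ, hγ⟩ := hy'
  have hpim : p.im = Φ.c - Φ.η := by simpa [bottom, mem_reProdIm] using hp.2
  set R : Set ℂ := Icc (Φ.a - 1) Φ.b ×ℂ Icc (Φ.c - Φ.η) Φ.d with hR
  have hRconv : Convex ℝ R := convex_Icc_reProdIm_Icc _ _ _ _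
  have hER : Φ.extRect ⊆ R := fun w hw => ⟨⟨by linarith [hw.1.1], hw.1.2⟩, hw.2⟩
  set K : Set ℂ := C ∪ segment ℝ z (z + ((-1 : ℝ) : ℝ)) with hK
  have hz1 : z + ((-1 : ℝ) : ℝ) ∈ R := by
    have hzR := hER (Φ.rect_subset_extRect (hCr hz))
    exact ⟨⟨by simp [hzre], by simp; linarith [hzR.1.2]⟩, by simpa using hzR.2⟩
  have hKsub : K ⊆ R := union_subset (fun w hw => hER (Φ.rect_subset_extRect (hCr hw)))
    (hRconv.segment_subset (hER (Φ.rect_subset_extRect (hCr hz))) hz1)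
  have hKc : IsCompact K := hCc.union (isCompact_segment_complex _ _)
  have hKpc : IsPreconnected K :=
    (hCpc.union z hz (left_mem_segment ℝ _ _) (convex_segment _ _).isPreconnected)
  have hKa : ∃ w ∈ K, w.re = Φ.a - 1 :=
    ⟨z + ((-1 : ℝ) : ℝ), Or.inr (right_mem_segment ℝ _ _), by simp [hzre]; ring⟩
  have hKb : ∃ w ∈ K, w.re = Φ.b := by
    obtain ⟨w, hw, hwre⟩ := hCb; exact ⟨w, Or.inl hw, hwre⟩
  set y1 : ℂ := y + ((-1 : ℝ) : ℝ) with hy1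
  set q : ℂ := ⟨Φ.a - 1, Φ.d⟩ with hq
  have hyR : y ∈ R := hER hyE
  have hy1R : y1 ∈ R := ⟨⟨by simp [hy1, hyre], by simp [hy1]; linarith [hyR.1.2]⟩, by simpa [hy1] using hyR.2⟩
  have hqR : q ∈ R := ⟨⟨by simp [hq], by simp [hq]; linarith [Φ.hab]⟩,
    ⟨by simp [hq]; linarith [Φ.hcd, Φ.hη], by simp [hq]⟩⟩
  have hKseg : ∀ w ∈ segment ℝ z (z + ((-1 : ℝ) : ℝ)), w.im = z.im ∧ w.re ≤ z.re := fun w hw => by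
    obtain ⟨him, t, ht, hre⟩ := re_im_of_mem_segment_add hw
    exact ⟨him, by rw [hre]; nlinarith [ht.1]⟩
  have hnotK : ∀ w, w ∈ K → Φ.a ≤ w.re → w ∈ C := by
    rintro w (hw | hw) hwre
    · exact hw
    · obtain ⟨him, t, ht, hre⟩ := re_im_of_mem_segment_add hw
      have ht0 : t = 0 := by
        rw [hzre] at hre
        nlinarith [ht.1]
      have : w = z := Complex.ext (by rw [hre, ht0]; ring) him
      rw [this]; exact hz
  set P : Path p q := (γ.trans (segPath y y1)).trans (segPath y1 q) with hP
  have hPrange : range P ⊆ R \ K := by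
    rw [hP, Path.trans_range, Path.trans_range, range_segPath, range_segPath]
    refine union_subset (union_subset ?_ ?_) ?_
    · rintro _ ⟨s, rfl⟩
      refine ⟨hER (hγ s).1, fun hsK => (hγ s).2 (hnotK _ hsK (hγ s).1.1.1)⟩
    · intro w hw
      refine ⟨hRconv.segment_subset hyR hy1R hw, fun hwK => ?_⟩
      obtain ⟨him, t, ht, hre⟩ := re_im_of_mem_segment_add hw
      rcases hwK with hwC | hwS
      · have hwre : Φ.a ≤ w.re := (hCr hwC).1.1
        have ht0 : t = 0 := by rw [hyre] at hre; nlinarith [ht.1]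
        have : w = y := Complex.ext (by rw [hre, ht0]; ring) him
        exact hyC (this ▸ hwC)
      · have := (hKseg w hwS).1
        rw [him] at this
        linarith
    · intro w hw
      refine ⟨hRconv.segment_subset hy1R hqR hw, fun hwK => ?_⟩
      obtain ⟨t, ht, hre, him⟩ := exists_of_mem_segment hw
      have hwre : w.re = Φ.a - 1 := by rw [hre]; simp [hy1, hq, hyre]; ring
      rcases hwK with hwC | hwS
      · have := (hCr hwC).1.1
        rw [hwre] at this; linarith
      · have h1 := (hKseg w hwS).1
        have hyd : y.im ≤ Φ.d := hyR.2.2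
        have : w.im = y.im + t * (Φ.d - y.im) := by rw [him]; simp [hy1, hq]
        rw [this] at h1
        nlinarith [ht.1, ht.2]
  have hac : Φ.c - Φ.η ≤ Φ.d := by linarith [Φ.hcd, Φ.hη]
  obtain ⟨t, ht, htK⟩ := exists_mem_of_isPreconnected_crossing (show Φ.a - 1 ≤ Φ.b by linarith [Φ.hab])
    hac hKc hKpc hKsub hKa hKb (β := fun t => P.extend t) P.continuous_extend.continuousOn
    (fun t ht => by show P.extend t ∈ _; rw [P.extend_apply ht]; exact (hPrange (mem_range_self _)).1)
    (show (P.extend 0).im = Φ.c - Φ.η by rw [P.extend_zero, hpim])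
    (show (P.extend 1).im = Φ.d by rw [P.extend_one])
  rw [P.extend_apply ht] at htK
  exact (hPrange (mem_range_self _)).2 htK

end Frame

end SSContinuity

end Literature.Probability.Percolation

end

/-! ## Part `QuadCrossingExplorationFresh` -/

section
open Set Metric Filter Function
open _root_.Topology
open Literature.Probability.LatticeModels
open Literature.Topology.PlaneTopology

namespace Literature.Probability.Percolation

namespace SSContinuity

namespace Frame

variable (Φ : Frame) {D : Set ℂ} {Q Q' : QuadCrossing.Quad D} {ω : BondConfig (Site 2)}

/-- A point of `[Q']` on the boundary of the larger quad `[Q] ⊇ [Q']` is on the boundary of `[Q']`.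
[folklore] -/
theorem mem_frontier_of_mem_frontier_of_subset (hcar : Q'.carrier ⊆ Q.carrier) {e : ℂ}
    (he : e ∈ Q'.carrier) (hef : e ∈ frontier Q.carrier) : e ∈ frontier Q'.carrier := by
  rw [frontier_eq_closure_inter_closure]
  refine ⟨subset_closure he, ?_⟩
  rw [frontier_eq_closure_inter_closure] at hef
  exact closure_mono (compl_subset_compl.2 hcar) hef.2

variable {Φ} in
/-- **The explored region of `Q'` is below `W = G(Γ) ∪ E` in `[Q]`** (see the module docstring).
[cite: SchrammSmirnov2011, proof of Lemma 6.1] -/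
theorem Charts.image_explored_subset_below (hΦ : Φ.Charts Q') (hcar : Q'.carrier ⊆ Q.carrier)
    (h0 : Q'.side 0 = Q.side 0) (h1 : Q'.side 1 ⊆ Q.side 1) {Γ : Set ℂ}
    (hΓ : Φ.IsFrontierCrossing ω Γ) {E : Set ℂ} (hEc : IsCompact E) (hEQ : E ⊆ Q.carrier)
    (hWpc : IsPreconnected (Φ.G '' Γ ∪ E)) (hE2 : (E ∩ Q.side 2).Nonempty) {m : ℝ}
    (hAE : Φ.G '' {u | u ∈ Φ.rect ∧ u.re = Φ.b ∧ u.im ∈ Icc m (Φ.wallTop ω)} ⊆ E)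
    (hEm : ∀ u ∈ Φ.rect, u.re = Φ.b → Φ.G u ∈ E → m ≤ u.im) (hE0 : E ∩ Q'.side 0 = ∅)
    {p : ℂ} (hp : p ∈ Φ.explored ω) (hprect : p ∈ Φ.rect) :
    Φ.G p ∈ {z | z ∈ Q.carrier ∧ ∀ t ∈ Q.side 3, ∀ π : Path z t,
      range π ⊆ Q.carrier → (range π ∩ (Φ.G '' Γ ∪ E)).Nonempty} := by
  obtain ⟨-, hLQ', hLc, -, hL0', -⟩ := hΦ.image_isFrontierCrossing hΓ
  set W : Set ℂ := Φ.G '' Γ ∪ E with hW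
  have hΓc : IsCompact Γ := hΓ.2.1
  have hΓpc : IsPreconnected Γ := hΓ.2.2.1.isPreconnected
  have hΓr : Γ ⊆ Φ.rect := hΓ.subset_rect
  have hΓa : ∃ z ∈ Γ, z.re = Φ.a := hΓ.2.2.2.1
  have hΓb : ∃ z ∈ Γ, z.re = Φ.b := hΓ.2.2.2.2
  -- `W` is a compact connected subset of `[Q]` meeting `∂₀Q` and `∂₂Q`, so `∂₁Q` is below it
  have hWc : IsCompact W := hLc.union hEc
  have hWQ : W ⊆ Q.carrier := union_subset (hLQ'.trans hcar) hEQ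
  have hW0 : (W ∩ Q.side 0).Nonempty := by
    rw [← h0]; exact hL0'.mono (inter_subset_inter_left _ subset_union_left)
  have hW2 : (W ∩ Q.side 2).Nonempty := hE2.mono (inter_subset_inter_left _ subset_union_right)
  have hside1M := QuadCrossing.Quad.side_one_subset_below hWc hWpc hWQ hW0 hW2
  have hGpQ' : Φ.G p ∈ Q'.carrier := by rw [hΦ.carrier]; exact mem_image_of_mem _ hprect
  refine ⟨hcar hGpQ', fun t ht π hπ => ?_⟩
  by_contra hmiss
  have hπW : ∀ s, π s ∉ W := fun s h => hmiss ⟨π s, ⟨s, rfl⟩, h⟩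
  -- the path as a map `ℝ → ℂ`
  set f : ℝ → ℂ := fun s => π.extend s with hf
  have hfc : ContinuousOn f (Icc 0 1) := π.continuous_extend.continuousOn
  have hfW : ∀ s, f s ∉ W := fun s => hπW (projIcc 0 1 zero_le_one s)
  have hfQ : ∀ s, f s ∈ Q.carrier := fun s => hπ ⟨projIcc 0 1 zero_le_one s, rfl⟩
  have hf0 : f 0 = Φ.G p := π.extend_zero
  have hf1 : f 1 = t := π.extend_one
  -- the first exit from `[Q']`, or the endpoint: a time `s⋆` with `f([0, s⋆]) ⊆ [Q']` and
  -- `f s⋆ ∈ ∂[Q']`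
  obtain ⟨sStar, hsI, hgood, hfront⟩ : ∃ s₁ ∈ Icc (0 : ℝ) 1, (∀ s ∈ Icc (0 : ℝ) s₁, f s ∈ Q'.carrier) ∧
      f s₁ ∈ frontier Q'.carrier := by
    set B : Set ℝ := {s | s ∈ Icc (0 : ℝ) 1 ∧ f s ∉ Q'.carrier} with hB
    by_cases hBne : B.Nonempty
    · set s₁ : ℝ := sInf B with hs₁
      have hBbdd : BddBelow B := ⟨0, fun s hs => hs.1.1⟩
      have hs₁I : s₁ ∈ Icc (0 : ℝ) 1 :=
        ⟨le_csInf hBne fun s hs => hs.1.1, (csInf_le hBbdd hBne.some_mem).trans hBne.some_mem.1.2⟩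
      have hlt_good : ∀ s ∈ Icc (0 : ℝ) 1, s < s₁ → f s ∈ Q'.carrier := fun s hs hlt => by
        by_contra h
        exact absurd (csInf_le hBbdd ⟨hs, h⟩) (not_le.2 hlt)
      have hs₁good : f s₁ ∈ Q'.carrier := by
        rcases hs₁I.1.eq_or_lt with h | h
        · rw [← h, hf0]; exact hGpQ'
        · have hGc : IsClosed (Icc (0 : ℝ) 1 ∩ f ⁻¹' Q'.carrier) :=
            hfc.preimage_isClosed_of_isClosed isClosed_Icc Q'.isCompact_carrier.isClosed
          have hcl : s₁ ∈ closure (Ico (0 : ℝ) s₁) := by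
            rw [closure_Ico h.ne]; exact ⟨h.le, le_rfl⟩
          have hsub : Ico (0 : ℝ) s₁ ⊆ Icc (0 : ℝ) 1 ∩ f ⁻¹' Q'.carrier := fun s hs =>
            ⟨⟨hs.1, hs.2.le.trans hs₁I.2⟩, hlt_good s ⟨hs.1, hs.2.le.trans hs₁I.2⟩ hs.2⟩
          exact (hGc.closure_subset_iff.2 hsub hcl).2
      refine ⟨s₁, hs₁I, fun s hs => ?_, ?_⟩
      · rcases hs.2.eq_or_lt with h | h
        · rw [h]; exact hs₁good
        · exact hlt_good s ⟨hs.1, h.le.trans hs₁I.2⟩ h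
      · by_contra hnf
        have hint : f s₁ ∈ interior Q'.carrier := by
          have : f s₁ ∈ closure Q'.carrier := subset_closure hs₁good
          rw [closure_eq_interior_union_frontier] at this
          exact this.resolve_right hnf
        have hnb := hfc s₁ hs₁I (isOpen_interior.mem_nhds hint)
        obtain ⟨ε, hε, hball⟩ := Metric.mem_nhdsWithin_iff.1 hnb
        obtain ⟨s, hsB, hslt⟩ := exists_lt_of_csInf_lt hBne (show s₁ < s₁ + ε by linarith)
        have hs₁le : s₁ ≤ s := csInf_le hBbdd hsB
        have hsball : s ∈ ball s₁ ε ∩ Icc (0 : ℝ) 1 :=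
          ⟨by rw [mem_ball, Real.dist_eq, abs_of_nonneg (by linarith)]; linarith, hsB.1⟩
        exact hsB.2 (interior_subset (hball hsball))
    · rw [not_nonempty_iff_eq_empty] at hBne
      have hall : ∀ s ∈ Icc (0 : ℝ) 1, f s ∈ Q'.carrier := fun s hs => by
        by_contra h
        have : s ∈ B := ⟨hs, h⟩
        rw [hBne] at this
        exact this
      refine ⟨1, right_mem_Icc.2 zero_le_one, fun s hs => hall s ⟨hs.1, hs.2⟩, ?_⟩
      have h1Q' := hall 1 (right_mem_Icc.2 zero_le_one)
      rw [hf1] at h1Q' ⊢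
      exact mem_frontier_of_mem_frontier_of_subset hcar h1Q' (Q.side_subset_frontier 3 ht)
  -- the exit point `e` and its chart preimage `ê`
  set e : ℂ := f sStar with he
  have heQ' : e ∈ Q'.carrier := hgood sStar ⟨hsI.1, le_rfl⟩
  set ê : ℂ := Φ.G.symm e with hê'
  have hê : Φ.G ê = e := Φ.G.apply_symm_apply e
  have hpreim : ∀ {w : ℂ}, w ∈ Q'.carrier → Φ.G.symm w ∈ Φ.rect := by
    intro w hw
    rw [hΦ.carrier] at hw
    obtain ⟨u, hu, rfl⟩ := hw
    rwa [Φ.G.symm_apply_apply]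
  have hêrect : ê ∈ Φ.rect := hpreim heQ'
  -- `ê ∈ belowSet Γ`: follow the path in the chart from `p` to `ê`
  have hpbelow : p ∈ Φ.belowSet Γ := Φ.explored_subset_belowSet hΓ.subset_obstacle hp
  have hmul : ∀ s ∈ Icc (0 : ℝ) 1, s * sStar ∈ Icc (0 : ℝ) sStar := fun s hs =>
    ⟨mul_nonneg hs.1 hsI.1, by nlinarith [hs.2, hsI.1]⟩
  have hêbelow : ê ∈ Φ.belowSet Γ := by
    refine Φ.mem_belowSet_of_joinedIn hpbelow
      (JoinedIn.ofLine (f := fun s => Φ.G.symm (f (s * sStar))) ?_ ?_ ?_ ?_)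
    · exact Φ.G.symm.continuous.comp_continuousOn (hfc.comp (by fun_prop) fun s hs =>
        ⟨(hmul s hs).1, (hmul s hs).2.trans hsI.2⟩)
    · show Φ.G.symm (f (0 * sStar)) = p
      rw [zero_mul, hf0, Φ.G.symm_apply_apply]
    · show Φ.G.symm (f (1 * sStar)) = ê
      rw [one_mul]
    · rintro _ ⟨s, hs, rfl⟩
      have hsg : f (s * sStar) ∈ Q'.carrier := hgood _ (hmul s hs)
      refine ⟨Φ.rect_subset_extRect (hpreim hsg), fun hΓ' => hfW (s * sStar) ?_⟩
      exact Or.inl ⟨_, hΓ', Φ.G.apply_symm_apply _⟩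
  have hêcl : ê ∈ closure (Φ.belowSet Γ) := subset_closure hêbelow
  have hêΓ : ê ∉ Γ := fun h => hfW sStar (Or.inl ⟨ê, h, hê⟩)
  -- the tail joins `e` to `t ∈ ∂₃Q` off `W`, so `e` is not below `W`
  have heM : e ∉ {z | z ∈ Q.carrier ∧ ∀ t ∈ Q.side 3, ∀ π : Path z t,
      range π ⊆ Q.carrier → (range π ∩ W).Nonempty} := by
    obtain ⟨hgc, hg0, hg1, -⟩ := QuadCrossing.exists_reparam hfc hsI.1 hsI.2 le_rfl
    obtain ⟨q, hq⟩ := QuadCrossing.exists_path_of_continuousOn hgc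
    have hq' : ∀ s : unitInterval, q s = f (sStar + (s : ℝ) * (1 - sStar)) := hq
    refine QuadCrossing.Quad.not_mem_below_of_path_avoiding ht
      (q.cast hg0.symm (show t = (fun s : ℝ => f (sStar + s * (1 - sStar))) 1 by rw [hg1, hf1]))
      ?_ fun s => ?_
    · rintro _ ⟨s, rfl⟩
      simpa only [Path.cast_coe, hq'] using hfQ (sStar + s * (1 - sStar))
    · simpa only [Path.cast_coe, hq'] using hfW (sStar + s * (1 - sStar))
  -- conclusion from a `W`-avoiding path of `[Q]` from `e` to a point of `∂₁Q`
  have hfinish : ∀ z ∈ Q.side 1, ∀ q : Path e z, range q ⊆ Q.carrier → (∀ s, q s ∉ W) → False :=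
    fun z hz q hq hqW => heM (QuadCrossing.Quad.mem_below_of_path (hside1M hz) (hcar heQ') q hq hqW)
  -- points of a vertical segment of the side of `R'` down to the bottom corner
  have hcorner : ∀ r : ℝ, (⟨r, Φ.c⟩ : ℂ).im = Φ.c := fun r => rfl
  -- case analysis on the side of `e`
  have hef : e ∈ frontier Q'.carrier := hfront
  rw [QuadCrossing.Quad.frontier_carrier] at hef
  rcases hef with ((he0 | he1) | he2) | he3
  · -- left side: `re ê = a`; go down the left side to the corner `Q'(0,0) ∈ ∂₁Q`
    rw [hΦ.side0] at he0
    obtain ⟨u, ⟨hu, hure⟩, hue⟩ := he0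
    have hêu : ê = u := by rw [hê', ← hue, Φ.G.symm_apply_apply]
    have hêre : ê.re = Φ.a := by rw [hêu]; exact hure
    set k : ℂ := ⟨Φ.a, Φ.c⟩ with hk
    have hkrect : k ∈ Φ.rect := ⟨⟨le_rfl, Φ.hab.le⟩, ⟨le_rfl, Φ.hcd.le⟩⟩
    have hk1 : Φ.G k ∈ Q.side 1 := h1 (by rw [hΦ.side1]; exact ⟨k, ⟨hkrect, rfl⟩, rfl⟩)
    have hsegpts : ∀ w ∈ segment ℝ ê k, w ∈ Φ.rect ∧ w.re = Φ.a ∧ w.im ≤ ê.im := fun w hw => by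
      obtain ⟨τ, hτ, hre, him⟩ := exists_of_mem_segment hw
      have hwre : w.re = Φ.a := by rw [hre, hêre]; simp [hk]
      have hêc : Φ.c ≤ ê.im := hêrect.2.1
      have hkim : k.im = Φ.c := rfl
      rw [hkim] at him
      refine ⟨⟨show w.re ∈ Icc Φ.a Φ.b by rw [hwre]; exact ⟨le_rfl, Φ.hab.le⟩,
        show w.im ∈ Icc Φ.c Φ.d from ⟨by nlinarith [hτ.1, hτ.2], by nlinarith [hτ.1, hτ.2, hêrect.2.2]⟩⟩,
        hwre, by nlinarith [hτ.1, hτ.2]⟩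
    have hsegW : ∀ w ∈ segment ℝ ê k, Φ.G w ∉ W := fun w hw => by
      obtain ⟨hwrect, hwre, hwim⟩ := hsegpts w hw
      rintro (⟨z, hzΓ, hzw⟩ | hwE)
      · have hz : z = w := Φ.G.injective hzw
        rw [hz] at hzΓ
        have := Φ.im_lt_of_mem_closure_belowSet_left hΓc hΓpc hΓr hΓb hêcl hêΓ hêre hzΓ hwre
        linarith
      · have hw0 : Φ.G w ∈ Q'.side 0 := by rw [hΦ.side0]; exact ⟨w, ⟨hwrect, hwre⟩, rfl⟩
        have : Φ.G w ∈ E ∩ Q'.side 0 := ⟨hwE, hw0⟩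
        rw [hE0] at this
        exact this
    refine hfinish _ hk1 (((segPath ê k).map Φ.G.continuous).cast hê.symm rfl) ?_ fun s => ?_
    · rintro _ ⟨s, rfl⟩
      rw [Path.cast_coe]
      show Φ.G (segPath ê k s) ∈ Q.carrier
      refine hcar ?_
      rw [hΦ.carrier]
      exact mem_image_of_mem _ (hsegpts _ (range_segPath ê k ▸ mem_range_self s)).1
    · rw [Path.cast_coe]
      exact hsegW _ (range_segPath ê k ▸ mem_range_self s)
  · -- bottom side: `e ∈ ∂₁Q' ⊆ ∂₁Q`
    exact hfinish e (h1 he1) (Path.refl e) (by rintro _ ⟨s, rfl⟩; exact hcar heQ')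
      fun s => by simpa using hfW sStar
  · -- right side: below the landing height, hence below `m`; go down to the corner `Q'(1,0)`
    rw [hΦ.side2] at he2
    obtain ⟨u, ⟨hu, hure⟩, hue⟩ := he2
    have hêu : ê = u := by rw [hê', ← hue, Φ.G.symm_apply_apply]
    have hêre : ê.re = Φ.b := by rw [hêu]; exact hure
    have hêtop : ê.im ≤ Φ.wallTop ω :=
      Φ.im_le_of_mem_closure_belowSet hΓc hΓpc hΓr hΓa hΓb
        (fun z hz hzre => Φ.im_le_wallTop (hΓ.subset_closure hz) hzre) hêcl hêre
    have hêm : ê.im < m := by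
      by_contra hge
      push Not at hge
      exact hfW sStar (Or.inr (hAE ⟨ê, ⟨hêrect, hêre, hge, hêtop⟩, hê⟩))
    set k : ℂ := ⟨Φ.b, Φ.c⟩ with hk
    have hkrect : k ∈ Φ.rect := ⟨⟨Φ.hab.le, le_rfl⟩, ⟨le_rfl, Φ.hcd.le⟩⟩
    have hk1 : Φ.G k ∈ Q.side 1 := h1 (by rw [hΦ.side1]; exact ⟨k, ⟨hkrect, rfl⟩, rfl⟩)
    have hsegpts : ∀ w ∈ segment ℝ ê k, w ∈ Φ.rect ∧ w.re = Φ.b ∧ w.im ≤ ê.im := fun w hw => by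
      obtain ⟨τ, hτ, hre, him⟩ := exists_of_mem_segment hw
      have hwre : w.re = Φ.b := by rw [hre, hêre]; simp [hk]
      have hêc : Φ.c ≤ ê.im := hêrect.2.1
      have hkim : k.im = Φ.c := rfl
      rw [hkim] at him
      refine ⟨⟨show w.re ∈ Icc Φ.a Φ.b by rw [hwre]; exact ⟨Φ.hab.le, le_rfl⟩,
        show w.im ∈ Icc Φ.c Φ.d from ⟨by nlinarith [hτ.1, hτ.2], by nlinarith [hτ.1, hτ.2, hêrect.2.2]⟩⟩,
        hwre, by nlinarith [hτ.1, hτ.2]⟩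
    have hsegW : ∀ w ∈ segment ℝ ê k, Φ.G w ∉ W := fun w hw => by
      obtain ⟨hwrect, hwre, hwim⟩ := hsegpts w hw
      rintro (⟨z, hzΓ, hzw⟩ | hwE)
      · have hz : z = w := Φ.G.injective hzw
        rw [hz] at hzΓ
        have := Φ.im_lt_of_mem_closure_belowSet_right hΓc hΓpc hΓr hΓa hêcl hêΓ hêre hzΓ hwre
        linarith
      · have := hEm w hwrect hwre hwE
        linarith
    refine hfinish _ hk1 (((segPath ê k).map Φ.G.continuous).cast hê.symm rfl) ?_ fun s => ?_
    · rintro _ ⟨s, rfl⟩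
      rw [Path.cast_coe]
      show Φ.G (segPath ê k s) ∈ Q.carrier
      refine hcar ?_
      rw [hΦ.carrier]
      exact mem_image_of_mem _ (hsegpts _ (range_segPath ê k ▸ mem_range_self s)).1
    · rw [Path.cast_coe]
      exact hsegW _ (range_segPath ê k ▸ mem_range_self s)
  · -- top side: impossible below `Γ`
    rw [hΦ.side3] at he3
    obtain ⟨u, ⟨-, huim⟩, hue⟩ := he3
    have hêu : ê = u := by rw [hê', ← hue, Φ.G.symm_apply_apply]
    have hlt := Φ.im_lt_d_of_mem_belowSet hΓc hΓpc hΓr hΓa hΓb hêbelow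
    rw [hêu, huim] at hlt
    exact lt_irrefl _ hlt

/-! ### Closed revealed edges leave the region only next to the exit set -/

/-- On the segment of a lattice edge, an endpoint lying between an interior point `q₀` and a
point `q` of the segment is `q`. [folklore] -/
theorem eq_of_endpoint_mem_segment {p₁ p₂ q₀ q w : ℂ} (hp : p₁ ≠ p₂)
    (hq₀ : q₀ ∈ openSegment ℝ p₁ p₂) (hq : q ∈ segment ℝ p₁ p₂) (hw : w ∈ segment ℝ q₀ q)
    (hwend : w = p₁ ∨ w = p₂) : w = q := by
  set φ := segParam p₁ p₂ with hφ
  have hφq₀ : φ q₀ ∈ Ioo (0 : ℝ) 1 := by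
    rw [openSegment_eq_image_lineMap] at hq₀
    obtain ⟨t, ht, rfl⟩ := hq₀
    rw [hφ, segParam_lineMap hp]; exact ht
  have hφq : φ q ∈ Icc (0 : ℝ) 1 := segParam_mem_Icc hp hq
  have hφ₁ : φ p₁ = 0 := by
    have := segParam_lineMap hp 0
    rwa [AffineMap.lineMap_apply_zero] at this
  have hφ₂ : φ p₂ = 1 := by
    have := segParam_lineMap hp 1
    rwa [AffineMap.lineMap_apply_one] at this
  obtain ⟨a, b, ha, hb, hab, rfl⟩ := hw
  have hcombo := segParam_combo p₁ p₂ q₀ q hab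
  -- `a = 0` in both cases
  have ha0 : a = 0 := by
    rcases hwend with h | h
    · rw [h, ← hφ, hφ₁] at hcombo
      by_contra ha0
      have : 0 < a := lt_of_le_of_ne ha (Ne.symm ha0)
      nlinarith [hφq₀.1, hφq.1]
    · rw [h, ← hφ, hφ₂] at hcombo
      by_contra ha0
      have : 0 < a := lt_of_le_of_ne ha (Ne.symm ha0)
      nlinarith [hφq₀.2, hφq.2]
  subst ha0
  have hb1 : b = 1 := by linarith
  subst hb1
  simp

variable {Φ} in
/-- **Closed revealed edges leave `M` only next to `E`.**  In the setting of
`Charts.image_explored_subset_below`, assume the larger quad is tame at the lattice scale: every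
drawn edge segment meets `[Q]` in a preconnected set.  If `e = {a, b}` is a closed edge revealed by
`Λ` (`Frame.revealedIn`) and `q` is a point of its segment inside `[Q]` which is not below
`W = G(Γ) ∪ E`, then `q` is a lattice vertex or the segment of `e` meets `E`.  (The revealing point
of the open segment is explored, hence below `W`; the sub-segment from it to `q` lies in `[Q]` by
tameness and must meet `W`, not at an interior point of `G(Γ)` — the edge is closed — so at an
endpoint, which is then `q`, or at `E`.) [cite: SchrammSmirnov2011, proof of Lemma 6.1] -/
theorem Charts.mem_range_or_exists_mem_of_revealedIn (hΦ : Φ.Charts Q') (hcar : Q'.carrier ⊆ Q.carrier)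
    (h0 : Q'.side 0 = Q.side 0) (h1 : Q'.side 1 ⊆ Q.side 1) {Γ : Set ℂ}
    (hΓ : Φ.IsFrontierCrossing ω Γ) {E : Set ℂ} (hEc : IsCompact E) (hEQ : E ⊆ Q.carrier)
    (hWpc : IsPreconnected (Φ.G '' Γ ∪ E)) (hE2 : (E ∩ Q.side 2).Nonempty) {m : ℝ}
    (hAE : Φ.G '' {u | u ∈ Φ.rect ∧ u.re = Φ.b ∧ u.im ∈ Icc m (Φ.wallTop ω)} ⊆ E)
    (hEm : ∀ u ∈ Φ.rect, u.re = Φ.b → Φ.G u ∈ E → m ≤ u.im) (hE0 : E ∩ Q'.side 0 = ∅)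
    (htame : ∀ a b : Site 2, (zdGraph 2).Adj a b →
      IsPreconnected (segment ℝ (meshPoint Φ.δ a) (meshPoint Φ.δ b) ∩ Q.carrier))
    {a b : Site 2} (hab : (zdGraph 2).Adj a b) (hrev : s(a, b) ∈ Φ.revealedIn (Φ.explored ω))
    (hclosed : s(a, b) ∉ ω) {q : ℂ} (hq : q ∈ segment ℝ (meshPoint Φ.δ a) (meshPoint Φ.δ b))
    (hqQ : q ∈ Q.carrier)
    (hqM : q ∉ {z | z ∈ Q.carrier ∧ ∀ t ∈ Q.side 3, ∀ π : Path z t,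
      range π ⊆ Q.carrier → (range π ∩ (Φ.G '' Γ ∪ E)).Nonempty}) :
    q ∈ range (meshPoint Φ.δ) ∨ ∃ w ∈ segment ℝ (meshPoint Φ.δ a) (meshPoint Φ.δ b), w ∈ E := by
  obtain ⟨hLO, -, -, -, -, -⟩ := hΦ.image_isFrontierCrossing hΓ
  obtain ⟨x, y, -, hexy, u, hucl, hurect, huseg⟩ := hrev
  have hne : meshPoint Φ.δ a ≠ meshPoint Φ.δ b := meshPoint_ne_of_adj Φ.hδ.ne' hab
  set q₀ : ℂ := Φ.G u with hq₀
  have hq₀open : q₀ ∈ openSegment ℝ (meshPoint Φ.δ a) (meshPoint Φ.δ b) := by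
    rw [SSContinuity.openSegment_eq_of_sym2_eq hexy (meshPoint Φ.δ)]; exact huseg
  have hq₀seg : q₀ ∈ segment ℝ (meshPoint Φ.δ a) (meshPoint Φ.δ b) :=
    openSegment_subset_segment ℝ _ _ hq₀open
  -- the revealing point is explored, hence below `W`
  have hq₀drawn : q₀ ∉ Φ.drawn ω :=
    SSContinuity.not_mem_drawn_of_mem_openSegment Φ.hδ.ne' hab hclosed hq₀open
  have huΛ : u ∈ Φ.explored ω := Φ.mem_explored_of_mem_closure hucl fun h => hq₀drawn h.2
  have hq₀M := hΦ.image_explored_subset_below hcar h0 h1 hΓ hEc hEQ hWpc hE2 hAE hEm hE0 huΛ hurect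
  have hq₀Q : q₀ ∈ Q.carrier := hq₀M.1
  -- the sub-segment `[q₀, q]` lies in the segment and in `[Q]` (tameness)
  have hsub : segment ℝ q₀ q ⊆ segment ℝ (meshPoint Φ.δ a) (meshPoint Φ.δ b) ∩ Q.carrier :=
    segment_subset_of_isPreconnected_subset_segment (htame a b hab) inter_subset_left
      ⟨hq₀seg, hq₀Q⟩ ⟨hq, hqQ⟩
  by_contra hcon
  push Not at hcon
  obtain ⟨hqV, hqE⟩ := hcon
  -- `[q₀, q]` misses `W`
  have hWmiss : ∀ w ∈ segment ℝ q₀ q, w ∉ Φ.G '' Γ ∪ E := fun w hw => by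
    rintro (hwL | hwE)
    · have hwO : w ∈ openEdgeUnion Φ.δ ω := hLO hwL
      have hwseg : w ∈ segment ℝ (meshPoint Φ.δ a) (meshPoint Φ.δ b) := (hsub hw).1
      rw [← insert_endpoints_openSegment] at hwseg
      rcases hwseg with h | h | hwopen
      · have := eq_of_endpoint_mem_segment hne hq₀open hq hw (Or.inl h)
        exact hqV ⟨a, by rw [← this, h]⟩
      · have := eq_of_endpoint_mem_segment hne hq₀open hq hw (Or.inr h)
        exact hqV ⟨b, by rw [← this, h]⟩
      · exact SSContinuity.not_mem_drawn_of_mem_openSegment Φ.hδ.ne' hab hclosed hwopen (Or.inl hwO)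
    · exact hqE w (hsub hw).1 hwE
  -- hence `q` is below `W`: contradiction
  refine hqM (QuadCrossing.Quad.mem_below_of_path hq₀M hqQ (segPath q q₀) ?_ fun s => ?_)
  · rw [range_segPath, segment_symm]
    exact fun w hw => (hsub hw).2
  · exact hWmiss _ (by rw [segment_symm, ← range_segPath q q₀]; exact mem_range_self s)

end Frame

end SSContinuity

end Literature.Probability.Percolation

end

/-! ## Part `QuadCrossingExplorationExitSet` -/

section
open Set Metric Filter Function
open _root_.Topology
open Literature.Probability.LatticeModels
open Literature.Topology.PlaneTopology

namespace Literature.Probability.Percolation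

namespace SSContinuity

namespace Frame

variable (Φ : Frame) {D : Set ℂ} {Q Q' : QuadCrossing.Quad D} {ω : BondConfig (Site 2)}

/-- The initial segment of a path up to parameter `s`, as a path. [folklore] -/
def initialPath {x y : ℂ} (α : Path x y) (s : unitInterval) : Path x (α s) where
  toFun t := α.extend ((t : ℝ) * s)
  continuous_toFun := α.continuous_extend.comp (by fun_prop)
  source' := by simp
  target' := by simp

/-- Its range lies in the range of the path. [folklore] -/
theorem range_initialPath {x y : ℂ} (α : Path x y) (s : unitInterval) :
    range (initialPath α s) ⊆ range α := by
  rintro _ ⟨t, rfl⟩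
  exact ⟨projIcc 0 1 zero_le_one _, rfl⟩

variable {Φ} in
/-- **The exit set** (see the module docstring).  The frame is the standard one of
`Quad.exists_frame_charts` composed with the explicit chart (`hb`, `hc`, `hd`, `hG`).
[cite: SchrammSmirnov2011, Lemma 6.1 (2) and its proof] -/
theorem Charts.exists_exitSet (hΦ : Φ.Charts Q') (hb : Φ.b = 1) (hc : Φ.c = -1) (hd : Φ.d = 1)
    (hG : ∀ t : unitInterval, Φ.G ⟨1, 2 * (t : ℝ) - 1⟩ = Q' (1, t)) (hcr : Φ.Crossed Φ.b ω)
    {ρ K : ℝ} (hρ : 0 ≤ ρ) (hK : 1 ≤ K)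
    (harc : ∀ s t : unitInterval, dist (Q' (1, s)) (Q' (1, t)) ≤ ρ → ∀ u : unitInterval,
      ((s : ℝ) ≤ u ∧ (u : ℝ) ≤ t ∨ (t : ℝ) ≤ u ∧ (u : ℝ) ≤ s) → dist (Q' (1, u)) (Q' (1, s)) ≤ K * ρ)
    (hcar : Q'.carrier ⊆ Q.carrier) {y₂ : ℂ} (hy₂ : y₂ ∈ Q.side 2)
    (α₀ : Path (Φ.G (Φ.wallPt ω)) y₂) (hα₀Q : range α₀ ⊆ Q.carrier)
    (hα₀x : ∀ s, dist (α₀ s) (Φ.G (Φ.wallPt ω)) ≤ ρ) (hα₀0 : ∀ s, α₀ s ∉ Q'.side 0) :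
    ∃ (E : Set ℂ) (m : ℝ), IsCompact E ∧ IsPreconnected E ∧ E ⊆ Q.carrier ∧ Φ.G (Φ.wallPt ω) ∈ E ∧
      (E ∩ Q.side 2).Nonempty ∧
      (∀ e ∈ E, ∃ p : Path (Φ.G (Φ.wallPt ω)) e, range p ⊆ Q.carrier ∧
        ∀ s, dist (p s) (Φ.G (Φ.wallPt ω)) ≤ K * ρ) ∧
      Φ.G '' {u | u ∈ Φ.rect ∧ u.re = Φ.b ∧ u.im ∈ Icc m (Φ.wallTop ω)} ⊆ E ∧
      (∀ u ∈ Φ.rect, u.re = Φ.b → Φ.G u ∈ E → m ≤ u.im) ∧ E ∩ Q'.side 0 = ∅ := by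
  have hxhrect : Φ.wallPt ω ∈ Φ.rect := Φ.wallPt_mem_rect hcr
  have hxhre : (Φ.wallPt ω).re = Φ.b := rfl
  have hxhim : (Φ.wallPt ω).im = Φ.wallTop ω := rfl
  have hKρ : ρ ≤ K * ρ := by nlinarith
  -- chart side points as points of `∂₂Q'`
  have hside : ∀ y : ℝ, y ∈ Icc Φ.c Φ.d → ∃ t : unitInterval, (t : ℝ) = (y + 1) / 2 ∧
      Φ.G ⟨Φ.b, y⟩ = Q' (1, t) := by
    intro y hy
    rw [hc, hd] at hy
    refine ⟨⟨(y + 1) / 2, ⟨by linarith [hy.1], by linarith [hy.2]⟩⟩, rfl, ?_⟩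
    rw [← hG]
    congr 1
    apply Complex.ext <;> simp [hb]
    ring
  -- the contact set and its lowest height `m`
  set C : Set ℂ := {u | u ∈ Φ.rect ∧ u.re = Φ.b ∧ Φ.G u ∈ range α₀} with hC
  have hCc : IsCompact C := by
    have : C = Φ.rect ∩ ({u : ℂ | u.re = Φ.b} ∩ Φ.G ⁻¹' range α₀) := by
      ext u; exact ⟨fun h => ⟨h.1, h.2.1, h.2.2⟩, fun h => ⟨h.1, h.2.1, h.2.2⟩⟩
    rw [this]
    exact Φ.isCompact_rect.inter_right ((isClosed_eq Complex.continuous_re continuous_const).inter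
      ((isCompact_range α₀.continuous).isClosed.preimage Φ.G.continuous))
  have hxhC : (Φ.wallPt ω) ∈ C := ⟨hxhrect, hxhre, ⟨0, by rw [α₀.source]⟩⟩
  obtain ⟨um, humC, hummin⟩ := hCc.exists_isMinOn ⟨(Φ.wallPt ω), hxhC⟩ Complex.continuous_im.continuousOn
  set m : ℝ := um.im with hm
  have hmT : m ≤ (Φ.wallTop ω) := by rw [hm, ← hxhim]; exact hummin hxhC
  have hmc : Φ.c ≤ m := humC.1.2.1
  have hTd : (Φ.wallTop ω) ≤ Φ.d := by rw [← hxhim]; exact hxhrect.2.2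
  have humx : dist (Φ.G um) (Φ.G (Φ.wallPt ω)) ≤ ρ := by
    obtain ⟨s, hs⟩ := humC.2.2
    rw [← hs]; exact hα₀x s
  -- the arc `Â` (a vertical chart segment) and its image
  set Ah : Set ℂ := {u | u ∈ Φ.rect ∧ u.re = Φ.b ∧ u.im ∈ Icc m (Φ.wallTop ω)} with hAh
  have hmk : Continuous fun y : ℝ => (⟨Φ.b, y⟩ : ℂ) := by
    have : (fun y : ℝ => (⟨Φ.b, y⟩ : ℂ)) = fun y : ℝ => (Φ.b : ℂ) + (y : ℂ) * Complex.I := by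
      funext y; apply Complex.ext <;> simp
    rw [this]; fun_prop
  have hmemAh : ∀ y ∈ Icc m (Φ.wallTop ω), (⟨Φ.b, y⟩ : ℂ) ∈ Ah := fun y hy =>
    ⟨⟨⟨Φ.hab.le, le_rfl⟩, ⟨hmc.trans hy.1, hy.2.trans hTd⟩⟩, rfl, hy⟩
  have hAh_eq : Ah = (fun y : ℝ => (⟨Φ.b, y⟩ : ℂ)) '' Icc m (Φ.wallTop ω) := by
    refine subset_antisymm (fun u hu => ⟨u.im, hu.2.2, Complex.ext hu.2.1.symm rfl⟩) ?_
    rintro _ ⟨y, hy, rfl⟩; exact hmemAh y hy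
  have hAhc : IsCompact Ah := by rw [hAh_eq]; exact isCompact_Icc.image hmk
  have hAhpc : IsPreconnected Ah := by rw [hAh_eq]; exact isPreconnected_Icc.image _ hmk.continuousOn
  have hAhrect : Ah ⊆ Φ.rect := fun u hu => hu.1
  have hxhAh : (Φ.wallPt ω) ∈ Ah := ⟨hxhrect, hxhre, ⟨hmT, le_rfl⟩⟩
  have hum_eq : um = ⟨Φ.b, m⟩ := Complex.ext humC.2.1 rfl
  -- points of the arc are within `K ρ` of `(Φ.G (Φ.wallPt ω))`
  have harcpt : ∀ y ∈ Icc m (Φ.wallTop ω), dist (Φ.G ⟨Φ.b, y⟩) (Φ.G (Φ.wallPt ω)) ≤ K * ρ := by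
    intro y hy
    obtain ⟨ty, hty, hGy⟩ := hside y ⟨hmc.trans hy.1, hy.2.trans hTd⟩
    obtain ⟨tT, htT, hGT⟩ := hside (Φ.wallTop ω) ⟨hmc.trans hmT, hTd⟩
    obtain ⟨tm, htm, hGm⟩ := hside m ⟨hmc, hmT.trans hTd⟩
    have hxT : (Φ.G (Φ.wallPt ω)) = Q' (1, tT) := by rw [← hGT]; rfl
    have hdist : dist (Q' (1, tT)) (Q' (1, tm)) ≤ ρ := by
      rw [← hGT, ← hGm, ← hum_eq, dist_comm]; exact humx
    have := harc tT tm hdist ty (Or.inr ⟨by rw [htm, hty]; linarith [hy.1], by rw [hty, htT]; linarith [hy.2]⟩)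
    rwa [← hGy, ← hxT] at this
  -- the exit set
  set E : Set ℂ := range α₀ ∪ Φ.G '' Ah with hE
  have hAhQ : Φ.G '' Ah ⊆ Q.carrier := fun _ ⟨u, hu, hue⟩ =>
    hue ▸ hcar (by rw [hΦ.carrier]; exact mem_image_of_mem _ (hAhrect hu))
  refine ⟨E, m, (isCompact_range α₀.continuous).union (hAhc.image Φ.G.continuous),
    IsPreconnected.union (Φ.G (Φ.wallPt ω)) ⟨0, α₀.source⟩ ⟨(Φ.wallPt ω), hxhAh, rfl⟩
      (isConnected_range α₀.continuous).isPreconnected (hAhpc.image _ Φ.G.continuous.continuousOn),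
    union_subset hα₀Q hAhQ, Or.inl ⟨0, α₀.source⟩, ⟨y₂, Or.inl ⟨1, α₀.target⟩, hy₂⟩, ?_,
    subset_union_right, ?_, ?_⟩
  · -- junctions
    rintro e (⟨s, rfl⟩ | ⟨u, hu, rfl⟩)
    · refine ⟨initialPath α₀ s, (range_initialPath α₀ s).trans hα₀Q, fun t => ?_⟩
      obtain ⟨s', hs'⟩ := range_initialPath α₀ s ⟨t, rfl⟩
      rw [← hs']; exact (hα₀x s').trans hKρ
    · have huim : u.im ∈ Icc m (Φ.wallTop ω) := hu.2.2
      have hu_eq : u = ⟨Φ.b, u.im⟩ := Complex.ext hu.2.1 rfl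
      let q : Path (Φ.G (Φ.wallPt ω)) (Φ.G u) :=
        { toFun := fun t => Φ.G ⟨Φ.b, (Φ.wallTop ω) + (t : ℝ) * (u.im - (Φ.wallTop ω))⟩
          continuous_toFun := Φ.G.continuous.comp (hmk.comp (by fun_prop))
          source' := by simp [wallPt]
          target' := by
            conv_rhs => rw [hu_eq]
            simp }
      have hqpts : ∀ t : unitInterval, (Φ.wallTop ω) + (t : ℝ) * (u.im - (Φ.wallTop ω)) ∈ Icc m (Φ.wallTop ω) := fun t =>
        ⟨by nlinarith [t.2.1, t.2.2, huim.1, huim.2], by nlinarith [t.2.1, t.2.2, huim.2]⟩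
      refine ⟨q, ?_, fun t => harcpt _ (hqpts t)⟩
      rintro _ ⟨t, rfl⟩
      exact hAhQ ⟨_, hmemAh _ (hqpts t), rfl⟩
  · -- right-side contacts of `E` have height `≥ m`
    rintro u hurect hure (huα | ⟨v, hv, hvu⟩)
    · exact hummin (show u ∈ C from ⟨hurect, hure, huα⟩)
    · rw [← Φ.G.injective hvu]; exact hv.2.2.1
  · -- `E` misses `∂₀Q'`
    refine eq_empty_iff_forall_notMem.2 ?_
    rintro z ⟨(⟨s, rfl⟩ | ⟨v, hv, rfl⟩), hz0⟩
    · exact hα₀0 s hz0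
    · rw [hΦ.side0] at hz0
      obtain ⟨w, ⟨-, hwre⟩, hwv⟩ := hz0
      have := Φ.G.injective hwv
      rw [this] at hwre
      linarith [Φ.hab, hv.2.1, hwre]

end Frame

end SSContinuity

end Literature.Probability.Percolation

end

/-! ## Part `QuadCrossingNoInversion` -/

section
open Set Metric Function Complex
open _root_.Topology
open Literature.Topology.PlaneTopology

namespace Literature.Probability.Percolation

namespace SSContinuity

/-- **No inversion** (see the module docstring). [cite: SchrammSmirnov2011, proof of Lemma 6.1] -/
theorem im_le_im_of_access {a b c d η : ℝ} (hab : a ≤ b) (hη : 0 < η)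
    {Λ₁ Λ₃ : Set ℂ} (hΛ₁ : Λ₁ ⊆ Icc a b ×ℂ Icc (c - η) d) (hΛ₃ : Λ₃ ⊆ Icc a b ×ℂ Icc c (d + η))
    (hdisj : Disjoint Λ₁ Λ₃) {p₁ pH p₃ pL : ℂ} (hp₁ : p₁.im = c - η) (hp₃ : p₃.im = d + η)
    (hpH : pH.re = b) (hpL : pL.re = b) (hpH₃ : pH ∉ Λ₃) (hpL₁ : pL ∉ Λ₁)
    (π₁ : Path p₁ pH) (hπ₁ : ∀ t, π₁ t ∈ Λ₁ ∨ π₁ t = pH) (hπ₁R : ∀ t, π₁ t ∈ Icc a b ×ℂ Icc (c - η) d)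
    (π₃ : Path p₃ pL) (hπ₃ : ∀ t, π₃ t ∈ Λ₃ ∨ π₃ t = pL) (hπ₃R : ∀ t, π₃ t ∈ Icc a b ×ℂ Icc c (d + η)) :
    pH.im ≤ pL.im := by
  by_contra hlt
  push Not at hlt
  -- names
  set T : ℝ := pH.im with hT
  set B : ℝ := pL.im with hB
  have hpHR : pH ∈ Icc a b ×ℂ Icc (c - η) d := by simpa using hπ₁R 1
  have hpLR : pL ∈ Icc a b ×ℂ Icc c (d + η) := by simpa using hπ₃R 1
  have hp₁R : p₁ ∈ Icc a b ×ℂ Icc (c - η) d := by simpa using hπ₁R 0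
  have hp₃R : p₃ ∈ Icc a b ×ℂ Icc c (d + η) := by simpa using hπ₃R 0
  rw [mem_reProdIm] at hpHR hpLR hp₁R hp₃R
  have hTd : T ≤ d := hpHR.2.2
  have hBc : c ≤ B := hpLR.2.1
  -- auxiliary points
  set h₁ : ℂ := ⟨b + 1, T⟩ with hh₁
  set top₁ : ℂ := ⟨b + 1, d + η⟩ with htop₁
  set h₃ : ℂ := ⟨b + 1, B⟩ with hh₃
  set ℓ₃ : ℂ := ⟨a, d + η⟩ with hℓ₃
  -- the big rectangle
  set Rp : Set ℂ := Icc a (b + 1) ×ℂ Icc (c - η) (d + η) with hRp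
  have memRp : ∀ {z : ℂ}, a ≤ z.re → z.re ≤ b + 1 → c - η ≤ z.im → z.im ≤ d + η → z ∈ Rp :=
    fun h1 h2 h3 h4 => by rw [hRp, mem_reProdIm]; exact ⟨⟨h1, h2⟩, ⟨h3, h4⟩⟩
  -- the path: `π₁`, then right at height `T`, then up along `re = b + 1`
  let β : Path p₁ top₁ := (π₁.trans (Frame.segPath pH h₁)).trans (Frame.segPath h₁ top₁)
  have hβrange : range β = (range π₁ ∪ segment ℝ pH h₁) ∪ segment ℝ h₁ top₁ := by
    simp only [β, Path.trans_range, Frame.range_segPath]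
  -- the continuum: `π₃`, extended right at height `B` and left along the top row
  set C : Set ℂ := (range π₃ ∪ segment ℝ pL h₃) ∪ segment ℝ p₃ ℓ₃ with hC
  have hcs : ∀ x y : ℂ, IsCompact (segment ℝ x y) := fun x y => by
    rw [← Frame.range_segPath]; exact isCompact_range (Frame.segPath x y).continuous
  have hCc : IsCompact C :=
    ((isCompact_range π₃.continuous).union (hcs _ _)).union (hcs _ _)
  have hCpc : IsPreconnected C := by
    have h1 : IsPreconnected (range π₃ ∪ segment ℝ pL h₃) :=
      IsPreconnected.union pL ⟨1, π₃.target⟩ (left_mem_segment ℝ _ _)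
        (isConnected_range π₃.continuous).isPreconnected (convex_segment _ _).isPreconnected
    exact IsPreconnected.union p₃ (Or.inl ⟨0, π₃.source⟩) (left_mem_segment ℝ _ _) h1
      (convex_segment _ _).isPreconnected
  -- segments, pointwise
  have hsegH : ∀ w ∈ segment ℝ pH h₁, w.im = T ∧ b ≤ w.re ∧ w.re ≤ b + 1 := fun w hw => by
    obtain ⟨τ, hτ, hre, him⟩ := Frame.exists_of_mem_segment hw
    refine ⟨by rw [him, hh₁]; ring, ?_, ?_⟩
    · rw [hre, hpH, hh₁]; nlinarith [hτ.1]
    · rw [hre, hpH, hh₁]; nlinarith [hτ.2]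
  have hsegV : ∀ w ∈ segment ℝ h₁ top₁, w.re = b + 1 ∧ T ≤ w.im ∧ w.im ≤ d + η := fun w hw => by
    obtain ⟨τ, hτ, hre, him⟩ := Frame.exists_of_mem_segment hw
    refine ⟨by rw [hre, hh₁, htop₁]; ring, ?_, ?_⟩
    · rw [him, hh₁, htop₁]; nlinarith [hτ.1, hTd, hη.le]
    · rw [him, hh₁, htop₁]; nlinarith [hτ.2, hTd, hη.le]
  have hsegL : ∀ w ∈ segment ℝ pL h₃, w.im = B ∧ b ≤ w.re ∧ w.re ≤ b + 1 := fun w hw => by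
    obtain ⟨τ, hτ, hre, him⟩ := Frame.exists_of_mem_segment hw
    refine ⟨by rw [him, hh₃]; ring, ?_, ?_⟩
    · rw [hre, hpL, hh₃]; nlinarith [hτ.1]
    · rw [hre, hpL, hh₃]; nlinarith [hτ.2]
  have hsegT : ∀ w ∈ segment ℝ p₃ ℓ₃, w.im = d + η ∧ a ≤ w.re ∧ w.re ≤ b := fun w hw => by
    obtain ⟨τ, hτ, hre, him⟩ := Frame.exists_of_mem_segment hw
    refine ⟨by rw [him, hp₃, hℓ₃]; ring, ?_, ?_⟩
    · rw [hre, hℓ₃]; nlinarith [hτ.1, hτ.2, hp₃R.1.1, hp₃R.1.2]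
    · rw [hre, hℓ₃]; nlinarith [hτ.1, hτ.2, hp₃R.1.1, hp₃R.1.2, hab]
  -- side points of `Λ₃`-paths and of `Λ₁`-paths
  have hΛ₁re : ∀ w ∈ Λ₁, w.re ≤ b := fun w hw => ((mem_reProdIm.1 (hΛ₁ hw)).1).2
  have hΛ₁im : ∀ w ∈ Λ₁, w.im ≤ d := fun w hw => ((mem_reProdIm.1 (hΛ₁ hw)).2).2
  have hΛ₃re : ∀ w ∈ Λ₃, w.re ≤ b := fun w hw => ((mem_reProdIm.1 (hΛ₃ hw)).1).2
  -- `pH ∉ C`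
  have hpHC : pH ∉ C := by
    rintro ((⟨t, ht⟩ | hseg) | hseg)
    · rcases hπ₃ t with h | h
      · exact hpH₃ (ht ▸ h)
      · have : pH = pL := ht.symm.trans h
        have hTB : T = B := by rw [hT, hB, this]
        linarith
    · have := (hsegL pH hseg).1; linarith
    · have := (hsegT pH hseg).1; linarith [hη]
  -- the crossing lemma
  obtain ⟨t, -, ht⟩ := exists_mem_of_isPreconnected_crossing (β := fun t => β.extend t)
    (show a ≤ b + 1 by linarith) (show c - η ≤ d + η by linarith [hBc, hTd]) hCc hCpc
    (by
      rintro w ((⟨s, rfl⟩ | hw) | hw)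
      · have h := mem_reProdIm.1 (hπ₃R s)
        exact memRp h.1.1 (by linarith [h.1.2]) (by linarith [h.2.1, hη.le]) h.2.2
      · obtain ⟨h1, h2, h3⟩ := hsegL w hw
        exact memRp (by linarith) h3 (by linarith) (by linarith)
      · obtain ⟨h1, h2, h3⟩ := hsegT w hw
        exact memRp h2 (by linarith) (by linarith) h1.le)
    ⟨ℓ₃, Or.inr (right_mem_segment ℝ _ _), rfl⟩
    ⟨h₃, Or.inl (Or.inr (right_mem_segment ℝ _ _)), rfl⟩ β.continuous_extend.continuousOn
    (by
      intro s _
      show β.extend s ∈ Rp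
      have hs : β.extend s ∈ range β := by rw [← β.extend_range]; exact mem_range_self s
      rw [hβrange] at hs
      rcases hs with (⟨u, hu⟩ | hw) | hw
      · rw [← hu]
        have h := mem_reProdIm.1 (hπ₁R u)
        exact memRp h.1.1 (by linarith [h.1.2]) h.2.1 (by linarith [h.2.2, hη.le])
      · obtain ⟨h1, h2, h3⟩ := hsegH _ hw
        exact memRp (by linarith) h3 (by linarith [hpHR.2.1]) (by linarith)
      · obtain ⟨h1, h2, h3⟩ := hsegV _ hw
        exact memRp (by linarith) h1.le (by linarith [hpHR.2.1]) h3)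
    (by simp [hp₁]) (by simp [htop₁])
  -- the meeting point `w`
  set w : ℂ := β.extend t with hw
  have hwβ : w ∈ range β := by rw [← β.extend_range]; exact mem_range_self t
  rw [hβrange] at hwβ
  rcases hwβ with (⟨u, hu⟩ | hwH) | hwV
  · -- on `π₁`
    rcases hπ₁ u with h1 | h1
    · rw [hu] at h1
      -- `w ∈ Λ₁`
      rcases ht with ((⟨s, hs⟩ | hseg) | hseg)
      · rcases hπ₃ s with h3 | h3
        · exact hdisj.ne_of_mem h1 (hs ▸ h3) rfl
        · exact hpL₁ ((hs.symm.trans h3) ▸ h1)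
      · obtain ⟨him, hre, -⟩ := hsegL w hseg
        have hwre : w.re = b := le_antisymm (hΛ₁re w h1) hre
        -- the only point of that segment with `re = b` is `pL`
        have : w = pL := Complex.ext (by rw [hwre, hpL]) (by rw [him])
        exact hpL₁ (this ▸ h1)
      · have := (hsegT w hseg).1
        linarith [hΛ₁im w h1]
    · rw [hu] at h1
      exact hpHC (h1 ▸ ht)
  · -- on the horizontal extension at height `T`
    obtain ⟨him, hre, -⟩ := hsegH w hwH
    rcases ht with ((⟨s, hs⟩ | hseg) | hseg)
    · have hw3 : w ∈ Λ₃ ∨ w = pL := hs ▸ hπ₃ s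
      rcases hw3 with h3 | h3
      · have hwre : w.re = b := le_antisymm (hΛ₃re w h3) hre
        have : w = pH := Complex.ext (by rw [hwre, hpH]) (by rw [him])
        exact hpH₃ (this ▸ h3)
      · rw [h3] at him; linarith
    · have := (hsegL w hseg).1; linarith
    · have := (hsegT w hseg).1; linarith
  · -- on the vertical extension `re = b + 1`
    obtain ⟨hre, him, -⟩ := hsegV w hwV
    rcases ht with ((⟨s, hs⟩ | hseg) | hseg)
    · rcases hπ₃ s with h3 | h3
      · have := hΛ₃re _ h3; rw [hs] at this; linarith
      · have : w.re = b := by rw [← hs, h3, hpL]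
        linarith
    · obtain ⟨him', -, -⟩ := hsegL w hseg; linarith
    · obtain ⟨-, -, hre'⟩ := hsegT w hseg; linarith

end SSContinuity

end Literature.Probability.Percolation

end

/-! ## Part `QuadCrossingExplorationAccess` -/

section
open Set Metric Function
open _root_.Topology
open Literature.Probability.LatticeModels

namespace Literature.Probability.Percolation

namespace SSContinuity

/-! ### The drawn lattice near a point -/

/-- **Near `x`, the open edges are the open edge segments through `x`, and the only vertex is
(at most) `x`.** [folklore] -/
theorem exists_ball_drawn_subset {δ : ℝ} (hδ : 0 < δ) (ω : BondConfig (Site 2)) (x : ℂ) :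
    ∃ r > 0, (∀ w ∈ ball x r, w ∈ openEdgeUnion δ ω →
      ∃ a b : Site 2, (zdGraph 2).Adj a b ∧ s(a, b) ∈ ω ∧
        x ∈ segment ℝ (meshPoint δ a) (meshPoint δ b) ∧ w ∈ segment ℝ (meshPoint δ a) (meshPoint δ b)) ∧
      ∀ w ∈ ball x r, w ∈ range (meshPoint δ) → w = x := by
  -- the open edges not through `x`
  set ω' : BondConfig (Site 2) := {e | e ∈ ω ∧ ∀ a b : Site 2, e = s(a, b) → (zdGraph 2).Adj a b →
    x ∉ segment ℝ (meshPoint δ a) (meshPoint δ b)} with hω'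
  have hx : x ∉ openEdgeUnion δ ω' := fun h => by
    obtain ⟨a, b, hab, he, hxs⟩ := mem_openEdgeUnion_iff.1 h
    exact he.2 a b rfl hab hxs
  obtain ⟨r₁, hr₁, hball₁⟩ : ∃ r > 0, ball x r ⊆ (openEdgeUnion δ ω')ᶜ :=
    Metric.isOpen_iff.1 (QuadCrossing.isClosed_openEdgeUnion hδ ω').isOpen_compl x hx
  -- vertices other than `x`
  obtain ⟨r₂, hr₂, hball₂⟩ : ∃ r > 0, ∀ w ∈ ball x r, w ∈ range (meshPoint δ) → w = x := by
    by_cases hxv : x ∈ range (meshPoint δ)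
    · obtain ⟨v, rfl⟩ := hxv
      refine ⟨δ, hδ, ?_⟩
      rintro _ hw ⟨u, rfl⟩
      by_contra hne
      have := le_dist_meshPoint_of_ne hδ (fun h => hne (by rw [h]) : u ≠ v)
      exact absurd (mem_ball.1 hw) (not_lt.2 this)
    · obtain ⟨r, hr, hball⟩ :=
        Metric.isOpen_iff.1 (QuadCrossing.isClosed_range_meshPoint hδ).isOpen_compl x hxv
      exact ⟨r, hr, fun w hw hwv => absurd hwv (hball hw)⟩
  refine ⟨min r₁ r₂, lt_min hr₁ hr₂, fun w hw hwO => ?_,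
    fun w hw hwV => hball₂ w (ball_subset_ball (min_le_right _ _) hw) hwV⟩
  obtain ⟨a, b, hab, he, hws⟩ := mem_openEdgeUnion_iff.1 hwO
  by_cases hxs : x ∈ segment ℝ (meshPoint δ a) (meshPoint δ b)
  · exact ⟨a, b, hab, he, hxs, hws⟩
  · exfalso
    refine hball₁ (ball_subset_ball (min_le_left _ _) hw)
      (mem_openEdgeUnion_iff.2 ⟨a, b, hab, ⟨he, ?_⟩, hws⟩)
    intro a' b' he' hab'
    rw [← SSContinuity.segment_eq_of_sym2_eq he' (meshPoint δ)]
    exact hxs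

/-- Points of a line in the affine parameter: `lineMap A B u₀` lies on the segment from
`lineMap A B u₁` to `lineMap A B u₂` when `u₀` is between `u₁` and `u₂`. [folklore] -/
theorem lineMap_mem_segment_lineMap (A B : ℂ) {u₀ u₁ u₂ : ℝ}
    (h : u₁ ≤ u₀ ∧ u₀ ≤ u₂ ∨ u₂ ≤ u₀ ∧ u₀ ≤ u₁) :
    AffineMap.lineMap A B u₀ ∈ segment ℝ (AffineMap.lineMap A B u₁) (AffineMap.lineMap A B u₂) := by
  rw [segment_eq_image_lineMap]
  rcases eq_or_ne u₁ u₂ with heq | hne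
  · refine ⟨0, ⟨le_rfl, zero_le_one⟩, ?_⟩
    rw [AffineMap.lineMap_apply_zero]
    have : u₀ = u₁ := by rcases h with ⟨h1, h2⟩ | ⟨h1, h2⟩ <;> [skip; skip] <;> linarith
    rw [this]
  · refine ⟨(u₀ - u₁) / (u₂ - u₁), ?_, ?_⟩
    · rcases h with ⟨h1, h2⟩ | ⟨h1, h2⟩
      · have : 0 < u₂ - u₁ := by
          rcases (h1.trans h2).eq_or_lt with h' | h'
          · exact absurd h' hne
          · linarith
        exact ⟨div_nonneg (by linarith) this.le, (div_le_one this).2 (by linarith)⟩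
      · have : u₂ - u₁ < 0 := by
          rcases (h1.trans h2).eq_or_lt with h' | h'
          · exact absurd h'.symm hne
          · linarith
        exact ⟨div_nonneg_of_nonpos (by linarith) this.le, (div_le_one_of_neg this).2 (by linarith)⟩
    · have hsub : u₂ - u₁ ≠ 0 := sub_ne_zero.2 (Ne.symm hne)
      simp only [AffineMap.lineMap_apply_module]
      match_scalars <;> field_simp <;> ring

/-- **Radial closedness of the drawn lattice near `x`**: with `r` as in
`exists_ball_drawn_subset`, if `v'` is an undrawn point of `B(x, r)` then no point of the
segment `[v', x)` is drawn. [folklore] -/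
theorem not_mem_drawn_of_mem_segment {δ : ℝ} (hδ : 0 < δ) {ω : BondConfig (Site 2)} {x : ℂ} {r : ℝ}
    (hrO : ∀ w ∈ ball x r, w ∈ openEdgeUnion δ ω →
      ∃ a b : Site 2, (zdGraph 2).Adj a b ∧ s(a, b) ∈ ω ∧
        x ∈ segment ℝ (meshPoint δ a) (meshPoint δ b) ∧ w ∈ segment ℝ (meshPoint δ a) (meshPoint δ b))
    (hrV : ∀ w ∈ ball x r, w ∈ range (meshPoint δ) → w = x)
    {v' : ℂ} (hv' : v' ∈ ball x r) (hv'd : v' ∉ openEdgeUnion δ ω ∪ range (meshPoint δ))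
    {w : ℂ} (hw : w ∈ segment ℝ v' x) (hwx : w ≠ x) :
    w ∉ openEdgeUnion δ ω ∪ range (meshPoint δ) := by
  intro hwd
  have hr0 : 0 < r := by linarith [mem_ball.1 hv', dist_nonneg (x := v') (y := x)]
  have hwball : w ∈ ball x r := (convex_ball x r).segment_subset hv' (mem_ball_self hr0) hw
  rcases hwd with hwO | hwV
  swap
  · exact hwx (hrV w hwball hwV)
  obtain ⟨a, b, hab, he, hxs, hws⟩ := hrO w hwball hwO
  -- `x, w` on the open edge `e = [A, B]`; affine parameters along `e`
  set A : ℂ := meshPoint δ a with hA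
  set B : ℂ := meshPoint δ b with hB
  have hAB : A ≠ B := meshPoint_ne_of_adj hδ.ne' hab
  obtain ⟨ux, hux, hxe⟩ : ∃ u ∈ Icc (0 : ℝ) 1, AffineMap.lineMap A B u = x := by
    rw [segment_eq_image_lineMap] at hxs; exact hxs
  obtain ⟨uw, huw, hwe⟩ : ∃ u ∈ Icc (0 : ℝ) 1, AffineMap.lineMap A B u = w := by
    rw [segment_eq_image_lineMap] at hws; exact hws
  have hne : uw ≠ ux := fun h => hwx (by rw [← hwe, ← hxe, h])
  -- `w ∈ [v', x]`: `w = lineMap v' x θ` with `θ < 1`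
  obtain ⟨θ, hθ, hθw⟩ : ∃ θ ∈ Icc (0 : ℝ) 1, AffineMap.lineMap v' x θ = w := by
    rw [segment_eq_image_lineMap] at hw; exact hw
  have hθ1 : θ ≠ 1 := by
    rintro rfl
    rw [AffineMap.lineMap_apply_one] at hθw
    exact hwx hθw.symm
  have hθlt : θ < 1 := lt_of_le_of_ne hθ.2 hθ1
  -- hence `v' = lineMap A B uv` with
  set uv : ℝ := ux + (uw - ux) / (1 - θ) with huv
  have hv'eq : v' = AffineMap.lineMap A B uv := by
    have h1 : (1 - θ) ≠ 0 := by linarith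
    have key : (1 - θ) • v' = w - θ • x := by
      rw [← hθw, AffineMap.lineMap_apply_module]; module
    have hv : v' = (1 - θ)⁻¹ • (w - θ • x) := by
      rw [← key, smul_smul, inv_mul_cancel₀ h1, one_smul]
    rw [hv, ← hwe, ← hxe, huv]
    simp only [AffineMap.lineMap_apply_module]
    match_scalars <;> field_simp <;> ring
  -- `v'` is not on `e`, so `uv ∉ [0, 1]`
  have hv'e : v' ∉ segment ℝ A B := fun h =>
    hv'd (Or.inl (mem_openEdgeUnion_iff.2 ⟨a, b, hab, he, h⟩))
  have huv01 : uv < 0 ∨ 1 < uv := by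
    by_contra hcon
    push Not at hcon
    exact hv'e (by rw [hv'eq, segment_eq_image_lineMap]; exact ⟨uv, ⟨hcon.1, hcon.2⟩, rfl⟩)
  -- the endpoint of `e` beyond `w` is a vertex in `[w, v'] ⊆ B(x, r)`, hence `= x`: absurd
  have hseg_ball : segment ℝ w v' ⊆ ball x r := (convex_ball x r).segment_subset hwball hv'
  have param_x : ∀ {u : ℝ}, AffineMap.lineMap A B u = x → u = ux := fun {u} h => by
    have := congrArg (segParam A B) (h.trans hxe.symm)
    rwa [segParam_lineMap hAB, segParam_lineMap hAB] at this
  rcases huv01 with hneg | hbig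
  · -- direction of decreasing parameter: `uw < ux`, vertex `A` (parameter `0`)
    have huwx : uw < ux := by
      by_contra hge
      push Not at hge
      have : 0 ≤ (uw - ux) / (1 - θ) := div_nonneg (by linarith) (by linarith)
      linarith [hux.1]
    have hAseg : A ∈ segment ℝ w v' := by
      have := lineMap_mem_segment_lineMap A B (u₀ := 0) (u₁ := uw) (u₂ := uv) (Or.inr ⟨hneg.le, huw.1⟩)
      rwa [AffineMap.lineMap_apply_zero, hwe, ← hv'eq] at this
    have hA0 : A = x := hrV A (hseg_ball hAseg) ⟨a, rfl⟩
    have := param_x (u := 0) (by rw [AffineMap.lineMap_apply_zero]; exact hA0)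
    -- `ux = 0 > uw ≥ 0`
    linarith [huw.1]
  · have huwx : ux < uw := by
      by_contra hge
      push Not at hge
      have : (uw - ux) / (1 - θ) ≤ 0 := div_nonpos_of_nonpos_of_nonneg (by linarith) (by linarith)
      linarith [hux.2]
    have hBseg : B ∈ segment ℝ w v' := by
      have := lineMap_mem_segment_lineMap A B (u₀ := 1) (u₁ := uw) (u₂ := uv) (Or.inl ⟨huw.2, hbig.le⟩)
      rwa [AffineMap.lineMap_apply_one, hwe, ← hv'eq] at this
    have hB1 : B = x := hrV B (hseg_ball hBseg) ⟨b, rfl⟩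
    have := param_x (u := 1) (by rw [AffineMap.lineMap_apply_one]; exact hB1)
    linarith [huw.2]

/-! ### The access path -/

namespace Frame

variable (Φ : Frame) {D : Set ℂ} {Q' : QuadCrossing.Quad D} {ω : BondConfig (Site 2)}

variable {Φ} in
/-- **Access to the wall point from the explored region.**  If the frame charts `Q'`, `Q'` is
crossed, and `[Q']` is star-shaped at the landing point `x = G(wallPt)` with respect to its points
near `x`, then some explored point is joined to `wallPt` by a path all of whose points but the last
are explored. [cite: SchrammSmirnov2011, proof of Lemma 6.1] -/
theorem Charts.exists_access (hΦ : Φ.Charts Q') (hcr : Φ.Crossed Φ.b ω)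
    (hstar : ∃ r > 0, ∀ u ∈ Q'.carrier, u ∈ ball (Φ.G (Φ.wallPt ω)) r →
      segment ℝ (Φ.G (Φ.wallPt ω)) u ⊆ Q'.carrier) :
    ∃ v ∈ Φ.explored ω, ∃ γ : Path v (Φ.wallPt ω), ∀ t, γ t ∈ Φ.explored ω ∨ γ t = Φ.wallPt ω := by
  have hprect : Φ.wallPt ω ∈ Φ.rect := Φ.wallPt_mem_rect hcr
  have hpobs : Φ.wallPt ω ∈ Φ.obstacle ω := Φ.wallPt_mem_obstacle hcr
  have hxd : Φ.G (Φ.wallPt ω) ∈ Φ.drawn ω := hpobs.2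
  have hpcl : Φ.wallPt ω ∈ closure (Φ.explored ω) := Φ.wallPt_mem_closure ω
  have hpc : Φ.c ≤ Φ.wallTop ω := hprect.2.1
  by_cases hc : Φ.wallTop ω = Φ.c
  · -- the bottom corner: vertical access through the margin below `R'`
    set q : ℂ := ⟨Φ.b, Φ.c - Φ.η / 2⟩ with hq
    have hη := Φ.hη
    have hqE : q ∈ Φ.extRect := by
      rw [extRect, Complex.mem_reProdIm]
      exact ⟨⟨Φ.hab.le, le_rfl⟩, ⟨by simp [hq]; linarith, by simp [hq]; linarith [Φ.hcd]⟩⟩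
    have hqΛ : q ∈ Φ.explored ω := Φ.mem_explored_of_im_lt hqE (by simp [hq]; linarith)
    refine ⟨q, hqΛ, segPath q (Φ.wallPt ω), fun t => ?_⟩
    rcases eq_or_lt_of_le t.2.2 with ht1 | ht1
    · right
      have : t = 1 := Subtype.ext ht1
      rw [this, Path.target]
    · left
      have hpt : (segPath q (Φ.wallPt ω)) t = AffineMap.lineMap q (Φ.wallPt ω) (t : ℝ) := rfl
      have him : ((segPath q (Φ.wallPt ω)) t).im = Φ.c - (1 - (t : ℝ)) * (Φ.η / 2) := by
        rw [hpt, AffineMap.lineMap_apply_module]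
        simp [hq, hc]; ring
      have hre : ((segPath q (Φ.wallPt ω)) t).re = Φ.b := by
        rw [hpt, AffineMap.lineMap_apply_module]
        simp [hq]; ring
      refine Φ.mem_explored_of_im_lt ?_ ?_
      · rw [extRect, Complex.mem_reProdIm, hre, him]
        refine ⟨⟨Φ.hab.le, le_rfl⟩, ⟨by nlinarith [t.2.1, t.2.2], by nlinarith [t.2.1, Φ.hcd.le]⟩⟩
      · rw [him]; nlinarith [t.2.1]
  · -- `wallTop > c`: a nearby explored point of `R'` and the straight segment to `x`
    have hcp : Φ.c < Φ.wallTop ω := lt_of_le_of_ne hpc (Ne.symm hc)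
    obtain ⟨r₁, hr₁, hrO, hrV⟩ := exists_ball_drawn_subset Φ.hδ ω (Φ.G (Φ.wallPt ω))
    obtain ⟨r₂, hr₂, hstar'⟩ := hstar
    have hU : {u : ℂ | Φ.G u ∈ ball (Φ.G (Φ.wallPt ω)) (min r₁ r₂) ∧ Φ.c < u.im} ∈ 𝓝 (Φ.wallPt ω) := by
      refine Filter.inter_mem ?_ ?_
      · exact Φ.G.continuous.continuousAt.preimage_mem_nhds (isOpen_ball.mem_nhds (mem_ball_self (lt_min hr₁ hr₂)))
      · exact (isOpen_lt continuous_const Complex.continuous_im).mem_nhds (by simpa using hcp)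
    obtain ⟨v, hvU, hvΛ⟩ := (mem_closure_iff_nhds.1 hpcl _ hU)
    obtain ⟨hvball, hvim⟩ := hvU
    have hvE := Φ.explored_subset_extRect ω hvΛ
    have hvrect : v ∈ Φ.rect := by
      rw [extRect, Complex.mem_reProdIm] at hvE
      exact ⟨hvE.1, ⟨hvim.le, hvE.2.2⟩⟩
    have hv'Q : Φ.G v ∈ Q'.carrier := by rw [hΦ.carrier]; exact mem_image_of_mem _ hvrect
    have hv'd : Φ.G v ∉ Φ.drawn ω := fun h => Φ.not_mem_obstacle_of_mem_explored hvΛ ⟨hvrect, h⟩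
    have hv'x : Φ.G v ≠ Φ.G (Φ.wallPt ω) := fun h => hv'd (h ▸ hxd)
    have hseg : segment ℝ (Φ.G (Φ.wallPt ω)) (Φ.G v) ⊆ Q'.carrier :=
      hstar' _ hv'Q (ball_subset_ball (min_le_right _ _) hvball)
    have hv'ball : Φ.G v ∈ ball (Φ.G (Φ.wallPt ω)) r₁ := ball_subset_ball (min_le_left _ _) hvball
    -- points of `[G v, x)` pulled back are in `R' ∖ obstacles`
    have hgood : ∀ τ ∈ Ico (0 : ℝ) 1,
        Φ.G.symm (AffineMap.lineMap (Φ.G v) (Φ.G (Φ.wallPt ω)) τ) ∈ Φ.extRect \ Φ.obstacle ω := by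
      intro τ hτ
      set z : ℂ := AffineMap.lineMap (Φ.G v) (Φ.G (Φ.wallPt ω)) τ with hz
      have hzseg : z ∈ segment ℝ (Φ.G v) (Φ.G (Φ.wallPt ω)) := by
        rw [segment_eq_image_lineMap]; exact ⟨τ, ⟨hτ.1, hτ.2.le⟩, rfl⟩
      have hzx : z ≠ Φ.G (Φ.wallPt ω) := fun h => by
        have h' : (1 - τ) • (Φ.G v - Φ.G (Φ.wallPt ω)) = 0 := by
          have := h
          rw [hz, AffineMap.lineMap_apply_module] at this
          calc (1 - τ) • (Φ.G v - Φ.G (Φ.wallPt ω))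
              = ((1 - τ) • Φ.G v + τ • Φ.G (Φ.wallPt ω)) - Φ.G (Φ.wallPt ω) := by module
            _ = 0 := by rw [this, sub_self]
        rcases smul_eq_zero.1 h' with h1 | h1
        · linarith [hτ.2]
        · exact hv'x (sub_eq_zero.1 h1)
      have hzd : z ∉ Φ.drawn ω :=
        not_mem_drawn_of_mem_segment Φ.hδ hrO hrV hv'ball hv'd hzseg hzx
      have hzQ : z ∈ Q'.carrier := hseg (by rw [segment_symm]; exact hzseg)
      have hzrect : Φ.G.symm z ∈ Φ.rect := by
        rw [hΦ.carrier] at hzQ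
        obtain ⟨u, hu, huz⟩ := hzQ
        rw [← huz, Φ.G.symm_apply_apply]; exact hu
      exact ⟨Φ.rect_subset_extRect hzrect, fun h => hzd (by simpa using h.2)⟩
    -- the path
    let γ : Path v (Φ.wallPt ω) :=
      { toFun := fun t => Φ.G.symm (AffineMap.lineMap (Φ.G v) (Φ.G (Φ.wallPt ω)) (t : ℝ))
        continuous_toFun := Φ.G.symm.continuous.comp
          (AffineMap.lineMap_continuous.comp continuous_subtype_val)
        source' := by simp
        target' := by simp }
    refine ⟨v, hvΛ, γ, fun t => ?_⟩
    rcases eq_or_lt_of_le t.2.2 with ht1 | ht1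
    · right
      have : t = 1 := Subtype.ext ht1
      rw [this, Path.target]
    · left
      refine Φ.mem_explored_of_joinedIn hvΛ (JoinedIn.ofLine
        (f := fun s : ℝ => Φ.G.symm (AffineMap.lineMap (Φ.G v) (Φ.G (Φ.wallPt ω)) (s * t))) ?_ ?_ ?_ ?_)
      · exact Φ.G.symm.continuous.comp_continuousOn
          ((AffineMap.lineMap_continuous.comp (continuous_id.mul continuous_const)).continuousOn)
      · simp
      · simp [γ]
      · rintro _ ⟨s, hs, rfl⟩
        exact hgood _ ⟨mul_nonneg hs.1 t.2.1, by nlinarith [hs.2, t.2.1]⟩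

end Frame

end SSContinuity

end Literature.Probability.Percolation

end

/-! ## Part `QuadCrossingExplorationFlipFrame` -/

section
open Set Metric Function Complex
open _root_.Topology
open scoped ComplexConjugate
open Literature.Probability.LatticeModels
open Literature.Topology.PlaneTopology

namespace Literature.Probability.Percolation

namespace SSContinuity

namespace Frame

variable (Φ : Frame) {D : Set ℂ} {Q' : QuadCrossing.Quad D} {ω : BondConfig (Site 2)}

/-- Complex conjugation as a self-homeomorphism of the plane. [folklore] -/
def conjH : ℂ ≃ₜ ℂ where
  toFun := conj
  invFun := conj
  left_inv := Complex.conj_conj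
  right_inv := Complex.conj_conj
  continuous_toFun := Complex.continuous_conj
  continuous_invFun := Complex.continuous_conj

/-- `conjH_re`: structural lemma for the definition above. [folklore] -/
@[simp] theorem conjH_re (u : ℂ) : (conjH u).re = u.re := Complex.conj_re u

/-- `conjH_im`: structural lemma for the definition above. [folklore] -/
@[simp] theorem conjH_im (u : ℂ) : (conjH u).im = -u.im := Complex.conj_im u

/-- `conjH_conjH`: structural lemma for the definition above. [folklore] -/
@[simp] theorem conjH_conjH (u : ℂ) : conjH (conjH u) = u := Complex.conj_conj u

/-- `conjH_mk`: structural lemma for the definition above. [folklore] -/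
theorem conjH_mk (x y : ℝ) : conjH ⟨x, y⟩ = ⟨x, -y⟩ := Complex.ext (by simp) (by simp)

/-- **The flipped frame**: chart `G ∘ conj`, rectangle reflected in the real axis.
[cite: SchrammSmirnov2011, proof of Lemma 6.1] -/
def flipFrame : Frame where
  G := conjH.trans Φ.G
  a := Φ.a
  b := Φ.b
  c := -Φ.d
  d := -Φ.c
  η := Φ.η
  δ := Φ.δ
  Δ := Φ.Δ
  hab := Φ.hab
  hcd := by linarith [Φ.hcd]
  hη := Φ.hη
  hδ := Φ.hδ
  hΔ := Φ.hΔ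

/-- `flipFrame_G_apply`: structural lemma for the definition above. [folklore] -/
@[simp] theorem flipFrame_G_apply (u : ℂ) : Φ.flipFrame.G u = Φ.G (conjH u) := rfl

/-- `flipFrame_a`: structural lemma for the definition above. [folklore] -/
@[simp] theorem flipFrame_a : Φ.flipFrame.a = Φ.a := rfl

/-- `flipFrame_b`: structural lemma for the definition above. [folklore] -/
@[simp] theorem flipFrame_b : Φ.flipFrame.b = Φ.b := rfl

/-- `flipFrame_c`: structural lemma for the definition above. [folklore] -/
@[simp] theorem flipFrame_c : Φ.flipFrame.c = -Φ.d := rfl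

/-- `flipFrame_d`: structural lemma for the definition above. [folklore] -/
@[simp] theorem flipFrame_d : Φ.flipFrame.d = -Φ.c := rfl

/-- `flipFrame_η`: structural lemma for the definition above. [folklore] -/
@[simp] theorem flipFrame_η : Φ.flipFrame.η = Φ.η := rfl

/-- `flipFrame_δ`: structural lemma for the definition above. [folklore] -/
@[simp] theorem flipFrame_δ : Φ.flipFrame.δ = Φ.δ := rfl

/-- Conjugation maps the flipped rectangle onto the rectangle. [folklore] -/
theorem conjH_mem_rect_iff (u : ℂ) : conjH u ∈ Φ.rect ↔ u ∈ Φ.flipFrame.rect := by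
  simp only [rect, mem_reProdIm, conjH_re, conjH_im, flipFrame_a, flipFrame_b, flipFrame_c,
    flipFrame_d, mem_Icc]
  constructor
  · rintro ⟨h1, h2, h3⟩; exact ⟨h1, by linarith, by linarith⟩
  · rintro ⟨h1, h2, h3⟩; exact ⟨h1, by linarith, by linarith⟩

/-- The image of a reflected side set. [folklore] -/
theorem image_flipFrame_G (P : ℂ → Prop) :
    Φ.flipFrame.G '' {u | u ∈ Φ.flipFrame.rect ∧ P u} = Φ.G '' {v | v ∈ Φ.rect ∧ P (conjH v)} := by
  ext z
  constructor
  · rintro ⟨u, ⟨hu, hP⟩, rfl⟩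
    exact ⟨conjH u, ⟨(Φ.conjH_mem_rect_iff u).2 hu, by simpa using hP⟩, rfl⟩
  · rintro ⟨v, ⟨hv, hP⟩, rfl⟩
    refine ⟨conjH v, ⟨(Φ.conjH_mem_rect_iff _).1 (by simpa using hv), hP⟩, by simp⟩

/-- **The flipped frame charts the flipped quad.** [cite: SchrammSmirnov2011, proof of Lemma 6.1] -/
theorem Charts.flipFrame (hΦ : Φ.Charts Q') : Φ.flipFrame.Charts Q'.flip := by
  refine ⟨?_, ?_, ?_, ?_, ?_⟩
  · rw [QuadCrossing.Quad.flip_carrier, hΦ.carrier]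
    have := Φ.image_flipFrame_G (fun _ => True)
    simp only [and_true] at this
    rw [show {u | u ∈ Φ.flipFrame.rect} = Φ.flipFrame.rect from rfl,
      show {v | v ∈ Φ.rect} = Φ.rect from rfl] at this
    exact this.symm
  · rw [QuadCrossing.Quad.flip_side_zero, hΦ.side0, Φ.image_flipFrame_G]
    simp
  · rw [QuadCrossing.Quad.flip_side_one, hΦ.side3, Φ.image_flipFrame_G]
    congr 1
    ext v
    simp only [mem_setOf_eq, conjH_im, flipFrame_c, neg_inj]
  · rw [QuadCrossing.Quad.flip_side_two, hΦ.side2, Φ.image_flipFrame_G]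
    simp
  · rw [QuadCrossing.Quad.flip_side_three, hΦ.side1, Φ.image_flipFrame_G]
    congr 1
    ext v
    simp only [mem_setOf_eq, conjH_im, flipFrame_d, neg_inj]

/-- The chart formula on the free side passes to the flipped frame.
[cite: SchrammSmirnov2011, proof of Lemma 6.1] -/
theorem flipFrame_chart (hG : ∀ t : unitInterval, Φ.G ⟨1, 2 * (t : ℝ) - 1⟩ = Q' (1, t)) :
    ∀ t : unitInterval, Φ.flipFrame.G ⟨1, 2 * (t : ℝ) - 1⟩ = Q'.flip (1, t) := by
  intro t
  rw [flipFrame_G_apply, conjH_mk, QuadCrossing.Quad.flip_apply_one, ← hG]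
  congr 1
  apply Complex.ext
  · simp
  · simp [unitInterval.coe_symm_eq]; ring

/-- Obstacles of the flipped frame are the reflected obstacles. [folklore] -/
theorem conjH_mem_obstacle_iff (u : ℂ) : conjH u ∈ Φ.obstacle ω ↔ u ∈ Φ.flipFrame.obstacle ω := by
  simp only [obstacle, mem_setOf_eq, conjH_mem_rect_iff, flipFrame_G_apply, drawn, flipFrame_δ]

/-- A chart crossing is a chart crossing of the flipped frame. [cite: SchrammSmirnov2011, proof of Lemma 6.1] -/
theorem Crossed.flipFrame (hcr : Φ.Crossed Φ.b ω) : Φ.flipFrame.Crossed Φ.flipFrame.b ω := by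
  obtain ⟨K, hKr, hKc, hKconn, hKO, ⟨za, hza, hzare⟩, ⟨zb, hzb, hzbre⟩⟩ := hcr
  refine ⟨conjH '' K, ?_, hKc.image conjH.continuous, hKconn.image _ conjH.continuous.continuousOn,
    ?_, ⟨conjH za, mem_image_of_mem _ hza, by simpa using hzare⟩,
    ⟨conjH zb, mem_image_of_mem _ hzb, by simpa using hzbre⟩⟩
  · rintro _ ⟨u, hu, rfl⟩
    exact (Φ.conjH_mem_rect_iff (conjH u)).1 (by rw [conjH_conjH]; exact hKr hu)
  · rintro _ ⟨u, hu, rfl⟩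
    show Φ.G (conjH (conjH u)) ∈ openEdgeUnion Φ.δ ω
    rw [conjH_conjH]; exact hKO u hu

/-- **The two explored regions are disjoint** when the frame is crossed: a common point would join
the bottom row to the top row off the chart crossing. [cite: SchrammSmirnov2011, proof of Lemma 6.1] -/
theorem disjoint_explored_flip (hcr : Φ.Crossed Φ.b ω) :
    Disjoint (Φ.explored ω) (conjH '' Φ.flipFrame.explored ω) := by
  obtain ⟨K, hKr, hKc, hKconn, hKO, hKa, hKb⟩ := hcr
  rw [disjoint_left]
  rintro v ⟨-, p₁, hp₁, hJ₁⟩ ⟨u, ⟨-, p₃, hp₃, hJ₃⟩, rfl⟩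
  -- `K ⊆ obstacles`
  have hKobs : K ⊆ Φ.obstacle ω := fun z hz => ⟨hKr hz, Or.inl (hKO z hz)⟩
  -- the big rectangle minus `K` contains both path regions
  set R : Set ℂ := Icc Φ.a Φ.b ×ℂ Icc (Φ.c - Φ.η) (Φ.d + Φ.η) with hR
  have h1 : Φ.extRect \ Φ.obstacle ω ⊆ R \ K := by
    rintro z ⟨hz, hzO⟩
    rw [extRect, mem_reProdIm] at hz
    exact ⟨by rw [hR, mem_reProdIm]; exact ⟨hz.1, hz.2.1, by linarith [hz.2.2, Φ.hη]⟩,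
      fun h => hzO (hKobs h)⟩
  have h3 : conjH '' (Φ.flipFrame.extRect \ Φ.flipFrame.obstacle ω) ⊆ R \ K := by
    rintro _ ⟨z, ⟨hz, hzO⟩, rfl⟩
    rw [extRect, mem_reProdIm] at hz
    simp only [flipFrame_a, flipFrame_b, flipFrame_c, flipFrame_d, flipFrame_η, mem_Icc] at hz
    refine ⟨by rw [hR, mem_reProdIm]; exact ⟨by simpa using hz.1, by simp; constructor <;> linarith [Φ.hη]⟩,
      fun h => hzO ?_⟩
    rw [← Φ.conjH_mem_obstacle_iff]
    exact hKobs h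
  have hJ : JoinedIn (R \ K) p₁ (conjH p₃) := by
    refine (hJ₁.mono h1).trans ?_
    have := hJ₃.map (f := conjH) conjH.continuous |>.mono h3
    exact this.symm
  have hp₁im : p₁.im = Φ.c - Φ.η := by
    have := hp₁.2; simpa using this
  have hp₃im : (conjH p₃).im = Φ.d + Φ.η := by
    have := hp₃.2
    simp only [flipFrame_c, flipFrame_η, mem_preimage, mem_singleton_iff] at this
    simp [this]; ring
  exact SSContinuity.not_joinedIn_diff_of_crossing Φ.hab.le (by linarith [Φ.hcd, Φ.hη]) hKc
    hKconn.isPreconnected (fun z hz => by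
      have := hKr hz
      rw [mem_reProdIm] at this
      rw [mem_reProdIm]
      exact ⟨this.1, by linarith [this.2.1, Φ.hη], by linarith [this.2.2, Φ.hη]⟩) hKa hKb hp₁im hp₃im hJ

/-- **No inversion, frame level**: granted access paths through the explored regions to the two
wall points, the top contact of `Λ` (from the bottom) is not above the bottom contact of the
explored-from-the-top region: `wallTop Φ + wallTop Φ.flipFrame ≤ 0`.
[cite: SchrammSmirnov2011, proof of Lemma 6.1] -/
theorem wallTop_add_wallTop_le (hcr : Φ.Crossed Φ.b ω)
    (acc₁ : ∃ v ∈ Φ.explored ω, ∃ γ : Path v (Φ.wallPt ω), ∀ t, γ t ∈ Φ.explored ω ∨ γ t = Φ.wallPt ω)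
    (acc₃ : ∃ v ∈ Φ.flipFrame.explored ω, ∃ γ : Path v (Φ.flipFrame.wallPt ω),
      ∀ t, γ t ∈ Φ.flipFrame.explored ω ∨ γ t = Φ.flipFrame.wallPt ω) :
    Φ.wallTop ω + Φ.flipFrame.wallTop ω ≤ 0 := by
  have hcr' := Crossed.flipFrame Φ hcr
  obtain ⟨v₁, hv₁, γ₁, hγ₁⟩ := acc₁
  obtain ⟨v₃, hv₃, γ₃, hγ₃⟩ := acc₃
  -- explorer paths
  obtain ⟨hv₁E, p₁, hp₁, hJ₁⟩ := hv₁
  obtain ⟨hv₃E, p₃, hp₃, hJ₃⟩ := hv₃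
  let e₁ : Path p₁ v₁ := hJ₁.somePath
  let e₃ : Path p₃ v₃ := hJ₃.somePath
  have he₁ : ∀ t, e₁ t ∈ Φ.explored ω := fun t =>
    Φ.mem_explored_of_path hp₁ e₁ (fun s => hJ₁.somePath_mem s) t
  have he₃ : ∀ t, e₃ t ∈ Φ.flipFrame.explored ω := fun t =>
    Φ.flipFrame.mem_explored_of_path hp₃ e₃ (fun s => hJ₃.somePath_mem s) t
  -- the two sets and paths in the chart of `Φ`
  set Λ₁ := Φ.explored ω with hΛ₁
  set Λ₃ := conjH '' Φ.flipFrame.explored ω with hΛ₃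
  let π₁ : Path p₁ (Φ.wallPt ω) := e₁.trans γ₁
  let π₃ : Path (conjH p₃) (conjH (Φ.flipFrame.wallPt ω)) := (e₃.trans γ₃).map conjH.continuous
  have hΛ₁sub : Λ₁ ⊆ Icc Φ.a Φ.b ×ℂ Icc (Φ.c - Φ.η) Φ.d := Φ.explored_subset_extRect ω
  have hΛ₃sub : Λ₃ ⊆ Icc Φ.a Φ.b ×ℂ Icc Φ.c (Φ.d + Φ.η) := by
    rintro _ ⟨u, hu, rfl⟩
    have h := Φ.flipFrame.explored_subset_extRect ω hu
    rw [extRect, mem_reProdIm] at h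
    simp only [flipFrame_a, flipFrame_b, flipFrame_c, flipFrame_d, flipFrame_η, mem_Icc] at h
    rw [mem_reProdIm]
    exact ⟨by simpa using h.1, by simp; constructor <;> linarith⟩
  have hwall₁ : Φ.wallPt ω ∈ Φ.obstacle ω := Φ.wallPt_mem_obstacle hcr
  have hwall₃ : conjH (Φ.flipFrame.wallPt ω) ∈ Φ.obstacle ω :=
    (Φ.conjH_mem_obstacle_iff _).2 (Φ.flipFrame.wallPt_mem_obstacle hcr')
  have key := SSContinuity.im_le_im_of_access (Λ₁ := Λ₁) (Λ₃ := Λ₃) Φ.hab.le Φ.hη hΛ₁sub hΛ₃sub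
    (Φ.disjoint_explored_flip hcr)
    (p₁ := p₁) (pH := Φ.wallPt ω) (p₃ := conjH p₃) (pL := conjH (Φ.flipFrame.wallPt ω))
    (by have := hp₁.2; simpa using this)
    (by
      have := hp₃.2
      simp only [flipFrame_c, flipFrame_η, mem_preimage, mem_singleton_iff] at this
      simp [this]; ring)
    rfl (by simp [wallPt])
    (by
      rintro ⟨u, hu, hu'⟩
      have : u = conjH (Φ.wallPt ω) := by rw [← conjH_conjH u, hu']
      rw [this] at hu
      exact Φ.flipFrame.not_mem_obstacle_of_mem_explored hu ((Φ.conjH_mem_obstacle_iff _).1 (by simpa using hwall₁)))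
    (fun h => Φ.not_mem_obstacle_of_mem_explored h hwall₃)
    π₁ (fun t => by
      show (e₁.trans γ₁) t ∈ Λ₁ ∨ (e₁.trans γ₁) t = Φ.wallPt ω
      rw [Path.trans_apply]
      split_ifs with h
      · exact Or.inl (he₁ _)
      · exact hγ₁ _)
    (fun t => by
      show (e₁.trans γ₁) t ∈ _
      rw [Path.trans_apply]
      split_ifs with h
      · exact hΛ₁sub (he₁ _)
      · rcases hγ₁ ⟨2 * (t : ℝ) - 1, _⟩ with h' | h'
        · exact hΛ₁sub h'
        · rw [h']; exact Φ.rect_subset_extRect (Φ.wallPt_mem_rect hcr))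
    π₃ (fun t => by
      show conjH ((e₃.trans γ₃) t) ∈ Λ₃ ∨ conjH ((e₃.trans γ₃) t) = conjH (Φ.flipFrame.wallPt ω)
      rw [Path.trans_apply]
      split_ifs with h
      · exact Or.inl ⟨_, he₃ _, rfl⟩
      · rcases hγ₃ ⟨2 * (t : ℝ) - 1, _⟩ with h' | h'
        · exact Or.inl ⟨_, h', rfl⟩
        · exact Or.inr (by rw [h']))
    (fun t => by
      show conjH ((e₃.trans γ₃) t) ∈ _
      have hmem : (e₃.trans γ₃) t ∈ Φ.flipFrame.extRect := by
        rw [Path.trans_apply]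
        split_ifs with h
        · exact Φ.flipFrame.explored_subset_extRect ω (he₃ _)
        · rcases hγ₃ ⟨2 * (t : ℝ) - 1, _⟩ with h' | h'
          · exact Φ.flipFrame.explored_subset_extRect ω h'
          · rw [h']; exact Φ.flipFrame.rect_subset_extRect (Φ.flipFrame.wallPt_mem_rect hcr')
      rw [extRect, mem_reProdIm] at hmem
      simp only [flipFrame_a, flipFrame_b, flipFrame_c, flipFrame_d, flipFrame_η, mem_Icc] at hmem
      rw [mem_reProdIm]
      exact ⟨by simpa using hmem.1, by simp; constructor <;> linarith⟩)
  have key' : (Φ.wallPt ω).im ≤ (conjH (Φ.flipFrame.wallPt ω)).im := key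
  simp only [wallPt_im, conjH_im] at key'
  linarith

end Frame

end SSContinuity

end Literature.Probability.Percolation

end
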